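import Literature.MathematicalPhysics.KineticTheory.DiPernaLionsExpSubsolution
import Literature.MathematicalPhysics.KineticTheory.DiPernaLionsTestedExpForm
import Literature.MathematicalPhysics.KineticTheory.DiPernaLionsGainLeLossHolds
import Literature.MathematicalPhysics.KineticTheory.DiPernaLionsStabilityHolds
import HarnessLib

/-!
# The DiPerna–Lions weak limit is an exponential supersolution; (L12), (S14) and weak stability hold

Topic: MathematicalPhysics / KineticTheory. This file proves the **supersolution half**
`f ≥ f₀ e^{-F} + T_F⁻¹ Q₊(f,f)` (Cercignani–Illner–Pulvirenti 1994 §5.3 Lemma 5.3.12, (3.38)–(3.40),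
p. 158) for every DiPerna–Lions weak limit — the hypothesis `hsup` of the proved assembly
`diPernaLions_limit_expDuhamel_of` (`DiPernaLionsExpDuhamel`) — and then discharges, with the
subsolution half `IsDiPernaLionsWeakLimit.isExpSubsolution` (`DiPernaLionsExpSubsolution`) and the
tree's reductions, the named facts (L12) `diPernaLions_limit_expDuhamel`, (S14)
`diPernaLions_limit_isAEMildSolution` and `diPernaLions_weakStability` (DiPerna–Lions, Ann. of
Math. 130 (1989), Theorem p. 322; `diperna_lions` itself then follows from the tree's
`diperna_lions_of_expDuhamel`). Everything is proved; theorems only; no definition and no named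
fact is introduced.

## The supersolution (in the tree's DiPerna–Lions generality)

CIP prove (3.38)–(3.40) through the truncations `gₘⁿ = (βₘ)(fⁿ)` and Lemma 5.3.11 iii) (pp. 156,
158), under their standing assumption (3.13). Here, for a fixed `t > 0` and a measurable set `C`
of characteristics, the exponential form (3.36) of `f^{φ(k)}` integrated over `C`
(`IsDiPernaLionsApproximateSolution.ofReal_sharp_eq_lintegral`) is bounded from below by the data
term plus the pairing of the post-collisional products with the Duhamel weights
`Θₖ = 1_{(0,t)}(s) 1_C(y - sv, v) e^{-(Λₖ♯(t)-Λₖ♯(s))} (1 + δₖ∫f^{φ(k)})⁻¹` (Tonelli and the shear,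
`setLIntegral_dampedGain_eq_lintegral`), truncated by the soft cutoff `χ_N(∫ f^{φ(k)} dξ)`, the
energy shell `|v|² + |v_*|² ≤ N²` and the kernel cut at height `N` (dropping nonnegative terms,
`setLIntegral_data_add_mainTerm_le_sharp`). The truncated pairings converge by velocity
averaging (`tendsto_lintegral_mainTerm_seq`, the main-term lemma of `DiPernaLionsGainUpperBound`
for test weights varying along the sequence and converging a.e., here the `Θₖ`, which converge in
`L¹` by `tendsto_lintegral_enorm_duhamelWeight_sub`: the damping increments converge
(`DiPernaLionsDampingLimit`, CIP Lemma 5.3.11 ii)) and `δₖ∫f^{φ(k)} → 0` in `L¹_loc`), along a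
subsequence with a.e. convergent velocity masses (CIP Lemma 5.3.11 i)) and weights; the data terms
converge (`eventually_setLIntegral_data_ge`) and `∫_C f^{φ(k)}♯(t) → ∫_C f♯(t)`
(`DiPernaLionsExpSubsolution.tendsto_setLIntegral_sharp`). Monotone convergence in the truncation
level (`tendsto_lintegral_truncatedLimit`, the collision flip `(v,v_*) ↔ (v',v_*')`) identifies
the supremum of the limits with `∫ Θ Q₊_B(f,f)`, `Θ = duhamelMultiplier t C F`, which dominates
`∫_C (T_F⁻¹Q₊(f,f))♯(t)` because the limit damping exponent is monotone in time along a.e.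
characteristic ((Lb), `setLIntegral_eDampedGainPrimitive_le`). The inequality on sets
(`IsDiPernaLionsWeakLimit.setLIntegral_sharp_ge`) gives the a.e. statement
`IsDiPernaLionsWeakLimit.isExpSupersolution` (`ae_le_of_forall_setLIntegral_le_of_sigmaFinite`).

## References

* R. J. DiPerna, P.-L. Lions, *On the Cauchy problem for Boltzmann equations: global existence and
  weak stability*, Ann. of Math. 130 (1989) 321–366, Theorem 1 and Theorem p. 322.
* C. Cercignani, R. Illner, M. Pulvirenti, *The Mathematical Theory of Dilute Gases*, Springer
  (1994), §5.3: Lemma 5.3.7 (p. 148), Lemma 5.3.11 (pp. 155–156), Step 13 (3.35)–(3.36) (p. 157),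
  Lemma 5.3.12 and its proof (pp. 157–159), Step 14 (pp. 159–160).
-/

open MeasureTheory Metric Real Set Filter Topology
open scoped InnerProductSpace ENNReal

noncomputable section

namespace Literature.MathematicalPhysics.KineticTheory

open Literature.Analysis.FluidPDE Literature.Analysis.FunctionSpaces

section MainSeq

universe u

variable {E : Type u} [NormedAddCommGroup E] [InnerProductSpace ℝ E] [FiniteDimensional ℝ E]
  [MeasurableSpace E] [BorelSpace E]

variable {B : E × E → sphere (0 : E) 1 → ℝ} {f₀ : E → E → ℝ} {δ : ℕ → ℝ}
  {Bseq : ℕ → E × E → sphere (0 : E) 1 → ℝ} {fseq : ℕ → ℝ → E → E → ℝ} {φ : ℕ → ℕ}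
  {f : ℝ → E → E → ℝ}

/-- **The main term passes to the limit** (CIP 1994 p. 160, "from the proof of Lemma 5.3.11":
the pairings of the normalised tensor products with bounded weights converge, by velocity
averaging; here along the weak-limit subsequence with a.e. convergent velocity masses). On the
energy shell `|v|² + |v_*|² ≤ R₁²`, with the kernel cut off at height `M` and the localisation
`χ_Λ(∫ f^{φ(k)} dξ)`, the tested post-collisional products
`∫ Φ(v) χ_Λ min(B_{φ(k)}, M) f^{φ(k)}(v') f^{φ(k)}(v_*')` converge, and the limit is at most
`∫ Φ Q₊_B(f,f)`. [cite: CIPDiluteGases1994, §5.3 Step 14 (p. 160) and Lemma 5.3.11 (pp. 155–156)] -/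
theorem tendsto_lintegral_mainTerm_seq (hB : IsDiPernaLionsKernel B) (hf₀ : HasDiPernaLionsData f₀)
    (hδ : ∀ n, 0 < δ n) (hanti : Antitone δ) (hlim : Tendsto δ atTop (𝓝 0))
    (hker : IsDiPernaLionsKernelApproximation B Bseq)
    (hdata : IsDiPernaLionsDataApproximation f₀ (fun n => fseq n 0))
    (hsol : ∀ n, IsDiPernaLionsApproximateSolution (δ n) (Bseq n) (fseq n))
    (hbd : UniformDiPernaLionsBounds δ Bseq fseq) (hW : IsDiPernaLionsWeakLimit f₀ fseq φ f) {T : ℝ}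
    (hT : 0 < T)
    (hmass : ∀ᵐ p : ℝ × E ∂(baseSlabMeasure E T),
      Tendsto (fun k => ∫ ξ, fseq (φ k) p.1 p.2 ξ) atTop (𝓝 (∫ ξ, f p.1 p.2 ξ)))
    {Φ : ℕ → ℝ × E × E → ℝ} (hΦm : ∀ k, Measurable (Φ k)) (hΦ0 : ∀ k z, 0 ≤ Φ k z) {CΦ : ℝ} (hCΦ0 : 0 ≤ CΦ)
    (hΦC : ∀ k z, Φ k z ≤ CΦ) {Φl : ℝ × E × E → ℝ} (hΦlm : Measurable Φl) (hΦl0 : ∀ z, 0 ≤ Φl z)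
    (hΦlC : ∀ z, Φl z ≤ CΦ)
    (hΦlim : ∀ᵐ z ∂(((volume : Measure ℝ).restrict (Ioc 0 T)).prod ((volume : Measure E).prod (volume : Measure E))),
      Tendsto (fun k => Φ k z) atTop (𝓝 (Φl z)))
    {M : ℝ} (hM : 0 ≤ M) {R₁ : ℝ} (hR₁ : 0 ≤ R₁) {Λ : ℝ} (hΛ : 0 ≤ Λ) :
    Tendsto (fun k => ∫⁻ y, ENNReal.ofReal (Φ k (y.1.1, y.1.2, y.2.1.1) *
          softCutoff Λ (∫ ξ, clampDensity (fseq (φ k)) (y.1.1, y.1.2, ξ)) *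
          ((velBall R₁).indicator (fun p => min (Bseq (φ k) p y.2.2) M) y.2.1 *
            (clampDensity (fseq (φ k)) (y.1.1, y.1.2, (collide y.2.2 y.2.1).1) *
              clampDensity (fseq (φ k)) (y.1.1, y.1.2, (collide y.2.2 y.2.1).2))))
        ∂((((volume : Measure ℝ).restrict (Ioc 0 T)).prod (volume : Measure E)).prod
          (((volume : Measure E).prod volume).prod (sphereMeasure (E := E))))) atTop
      (𝓝 (∫⁻ y in {y : (ℝ × E) × ((E × E) × sphere (0 : E) 1) | ‖y.2.1.1‖ ^ 2 + ‖y.2.1.2‖ ^ 2 ≤ R₁ ^ 2},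
        ENNReal.ofReal (f y.1.1 y.1.2 y.2.1.1 * f y.1.1 y.1.2 y.2.1.2 *
          (softCutoff Λ (∫ ξ, |f y.1.1 y.1.2 ξ|) * Φl (y.1.1, y.1.2, (collide y.2.2 y.2.1).2) *
            min (B y.2.1 y.2.2) M))
        ∂((((volume : Measure ℝ).restrict (Ioc 0 T)).prod (volume : Measure E)).prod
          (((volume : Measure E).prod volume).prod (sphereMeasure (E := E)))))) := by
  haveI := isFiniteMeasure_sphereMeasure (E := E)
  -- measures
  set μ₁ : Measure (ℝ × E) := ((volume : Measure ℝ).restrict (Ioc 0 T)).prod (volume : Measure E)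
    with hμ₁
  set μ₂ : Measure ((E × E) × sphere (0 : E) 1) :=
    ((volume : Measure E).prod volume).prod (sphereMeasure (E := E)) with hμ₂
  set ν : Measure ((ℝ × E) × ((E × E) × sphere (0 : E) 1)) := μ₁.prod μ₂ with hν
  set μZ : Measure (ℝ × E × E) := ((volume : Measure ℝ).restrict (Ioc 0 T)).prod
    ((volume : Measure E).prod (volume : Measure E)) with hμZ
  set S : Set ((ℝ × E) × ((E × E) × sphere (0 : E) 1)) :=
    {y | ‖y.2.1.1‖ ^ 2 + ‖y.2.1.2‖ ^ 2 ≤ R₁ ^ 2} with hS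
  have hSm : MeasurableSet S :=
    measurableSet_le ((measurable_snd.fst.fst.norm.pow_const 2).add
      (measurable_snd.fst.snd.norm.pow_const 2)) measurable_const
  set νs : Measure ((ℝ × E) × ((E × E) × sphere (0 : E) 1)) := ν.restrict S with hνs
  have hae_p : ∀ᵐ p ∂μ₁, p.1 ∈ Ioc 0 T :=
    (Measure.quasiMeasurePreserving_fst (μ := (volume : Measure ℝ).restrict (Ioc 0 T))
      (ν := (volume : Measure E))).ae (ae_restrict_mem measurableSet_Ioc)
  have hae_s : ∀ᵐ y ∂ν, y.1.1 ∈ Ioc 0 T := (Measure.quasiMeasurePreserving_fst (μ := μ₁) (ν := μ₂)).ae hae_p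
  have hae_z : ∀ᵐ z ∂μZ, z.1 ∈ Ioc 0 T :=
    (Measure.quasiMeasurePreserving_fst (μ := (volume : Measure ℝ).restrict (Ioc 0 T))
      (ν := (volume : Measure E).prod (volume : Measure E))).ae (ae_restrict_mem measurableSet_Ioc)
  -- the clamped densities
  set g : ℕ → ℝ → E → E → ℝ := fun k s x v => fseq (φ k) (max s 0) x v with hg
  have hgm : ∀ k, Measurable fun z : ℝ × E × E => g k z.1 z.2.1 z.2.2 := by
    intro k
    have hc : Continuous fun z : ℝ × E × E => ((max z.1 0, z.2) : ℝ × E × E) :=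
      (continuous_fst.max continuous_const).prodMk continuous_snd
    exact ((hsol (φ k)).continuousOn_uncurry.comp_continuous hc fun z =>
      mk_mem_prod (mem_Ici.2 (le_max_right _ _)) (mem_univ _)).measurable
  have hg0 : ∀ k s x v, 0 ≤ g k s x v := fun k s x v => (hsol (φ k)).nonneg _ (le_max_right _ _) _ _
  have hg_eq : ∀ k, ∀ s ∈ Ioc 0 T, ∀ x v, g k s x v = fseq (φ k) s x v := fun k s hs x v => by
    simp only [hg, max_eq_left hs.1.le]
  have hclamp : ∀ k z, clampDensity (fseq (φ k)) z = g k z.1 z.2.1 z.2.2 := fun k z => rfl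
  -- the hypotheses of `tensor_limits_of_velocityAverages` (as in `DiPernaLionsLimitEntropyAssembly`)
  obtain ⟨Cm, hCm⟩ := hbd.massEntropy_le T hT.le
  obtain ⟨Cl, hCl⟩ := hW.massEntropy_le T hT.le
  have hCg : ∀ k, ∀ s ∈ Ioc 0 T, ∫⁻ z : E × E, ENNReal.ofReal (g k s z.1 z.2 *
      (1 + ‖z.1‖ ^ 2 + ‖z.2‖ ^ 2 + |log (g k s z.1 z.2)|)) ∂((volume : Measure E).prod volume) ≤
      ENNReal.ofReal (max Cm Cl) := by
    intro k s hs
    simp only [hg_eq k s hs]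
    exact (hCm (φ k) s ⟨hs.1.le, hs.2⟩).trans (ENNReal.ofReal_le_ofReal (le_max_left _ _))
  have hCf : ∀ s ∈ Ioc 0 T, ∫⁻ z : E × E, ENNReal.ofReal |f s z.1 z.2|
      ∂((volume : Measure E).prod volume) ≤ ENNReal.ofReal (max Cm Cl) := by
    intro s hs
    refine le_trans (lintegral_mono fun z => ENNReal.ofReal_le_ofReal ?_)
      ((hCl s ⟨hs.1.le, hs.2⟩).trans (ENNReal.ofReal_le_ofReal (le_max_right _ _)))
    rw [abs_of_nonneg (hW.nonneg s hs.1.le _ _)]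
    refine le_mul_of_one_le_right (hW.nonneg s hs.1.le _ _) ?_
    nlinarith [sq_nonneg ‖z.1‖, sq_nonneg ‖z.2‖, abs_nonneg (log (f s z.1 z.2))]
  have hslab_ae : ∀ k, (fun z : ℝ × E × E => fseq (φ k) z.1 z.2.1 z.2.2) =ᵐ[μZ]
      fun z => g k z.1 z.2.1 z.2.2 := fun k => by
    filter_upwards [hae_z] with z hz
    exact (hg_eq k z.1 hz _ _).symm
  have hwslab : TendstoWeaklyL1 (fun k (z : ℝ × E × E) => g k z.1 z.2.1 z.2.2)
      (fun z => f z.1 z.2.1 z.2.2) μZ := by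
    have h := hW.tendstoWeaklyL1_slab T
    rw [slabMeasure_eq_restrict_Ioc_prod] at h
    exact h.congr_seq hslab_ae
  obtain ⟨hUI0, hUT0⟩ := uniformIntegrable_unifTight_slab hsol hbd T
  have hUI : UnifIntegrable (fun k (z : ℝ × E × E) => g k z.1 z.2.1 z.2.2) 1 μZ := by
    have h := (uniformIntegrable_comp_subseq hUI0 φ).2.1
    rw [slabMeasure_eq_restrict_Ioc_prod] at h
    exact h.ae_eq fun k => hslab_ae k
  have hUT : UnifTight (fun k (z : ℝ × E × E) => g k z.1 z.2.1 z.2.2) 1 μZ := by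
    have h := unifTight_comp_subseq hUT0 φ
    rw [slabMeasure_eq_restrict_Ioc_prod] at h
    exact h.aeeq fun k => hslab_ae k
  have hN4 : ∀ θ : ℝ × E × E → ℝ, Measurable θ → ∀ M' : ℝ, (∀ z, |θ z| ≤ M') →
      Tendsto (fun k => ∫ p, |(∫ w, g k p.1 p.2 w * θ (p.1, p.2, w)) -
          ∫ w, f p.1 p.2 w * θ (p.1, p.2, w)| ∂μ₁) atTop (𝓝 0) := by
    intro θ hθm M' hM'
    have h := tendsto_integral_abs_velocityAverage_sub velocityAverage_relativelyCompact_L1_holds hB hf₀ hδ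
      hanti hlim hker hdata hsol hbd hW (T := T) (ψ := fun _ => θ) (ψlim := θ) (M := M')
      (fun _ => hθm.aestronglyMeasurable) (fun _ => ae_of_all _ fun z => hM' z)
      (ae_of_all _ fun _ => tendsto_const_nhds)
    rw [baseSlabMeasure_eq_restrict_Ioc_prod] at h
    refine h.congr fun k => integral_congr_ae ?_
    filter_upwards [hae_p] with p hp
    simp only [velocityIntegral, hg_eq k p.1 hp]
  obtain ⟨hweak, hprod⟩ := tensor_limits_of_velocityAverages hgm hg0 hW.measurable
    (fun s hs => hW.nonneg s hs.le) hCg hCf hwslab hUI hUT hN4 one_pos hR₁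
  -- the normalised products and the weights
  set mk : ℕ → ℝ × E → ℝ := fun k p => ∫ w, |g k p.1 p.2 w| with hmk
  set ml : ℝ × E → ℝ := fun p => ∫ w, |f p.1 p.2 w| with hml
  have hmk0 : ∀ k p, 0 ≤ mk k p := fun k p => integral_nonneg fun _ => abs_nonneg _
  have hml0 : ∀ p, 0 ≤ ml p := fun p => integral_nonneg fun _ => abs_nonneg _
  have hmkm : ∀ k, Measurable (mk k) := fun k => measurable_integral_abs_slice (hgm k)
  have hmlm : Measurable ml := measurable_integral_abs_slice hW.measurable
  set P : ℕ → (ℝ × E) × ((E × E) × sphere (0 : E) 1) → ℝ := fun k y =>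
    (1 + 1 * ∫ w, |g k y.1.1 y.1.2 w|)⁻¹ * (g k y.1.1 y.1.2 y.2.1.1 * g k y.1.1 y.1.2 y.2.1.2) with hP
  set Pl : (ℝ × E) × ((E × E) × sphere (0 : E) 1) → ℝ := fun y =>
    (1 + 1 * ∫ w, |f y.1.1 y.1.2 w|)⁻¹ * (f y.1.1 y.1.2 y.2.1.1 * f y.1.1 y.1.2 y.2.1.2) with hPl
  set Ξ : ℕ → (ℝ × E) × ((E × E) × sphere (0 : E) 1) → ℝ := fun k y =>
    (1 + mk k y.1) * softCutoff Λ (mk k y.1) * Φ k (y.1.1, y.1.2, (collide y.2.2 y.2.1).2) *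
      min (Bseq (φ k) y.2.1 y.2.2) M with hΞ
  set Ξl : (ℝ × E) × ((E × E) × sphere (0 : E) 1) → ℝ := fun y =>
    (1 + ml y.1) * softCutoff Λ (ml y.1) * Φl (y.1.1, y.1.2, (collide y.2.2 y.2.1).2) *
      min (B y.2.1 y.2.2) M with hΞl
  -- bounds and measurability of the weights
  set CΞ : ℝ := (Λ + 2) * CΦ * M with hCΞ
  have hCΞ0 : 0 ≤ CΞ := by positivity
  have hcol : Measurable fun y : (ℝ × E) × ((E × E) × sphere (0 : E) 1) => collide y.2.2 y.2.1 :=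
    continuous_collide_uncurry.measurable.comp (measurable_snd.fst.prodMk measurable_snd.snd)
  have hΦc : ∀ k, Measurable fun y : (ℝ × E) × ((E × E) × sphere (0 : E) 1) => Φ k (y.1.1, y.1.2, (collide y.2.2 y.2.1).2) :=
    fun k => (hΦm k).comp (measurable_fst.fst.prodMk (measurable_fst.snd.prodMk hcol.snd))
  have hΦlc : Measurable fun y : (ℝ × E) × ((E × E) × sphere (0 : E) 1) => Φl (y.1.1, y.1.2, (collide y.2.2 y.2.1).2) :=
    hΦlm.comp (measurable_fst.fst.prodMk (measurable_fst.snd.prodMk hcol.snd))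
  have hweight_bound : ∀ {Ψ : ℝ × E × E → ℝ}, (∀ z, 0 ≤ Ψ z) → (∀ z, Ψ z ≤ CΦ) → ∀ {m : ℝ} {b : ℝ}, 0 ≤ m → 0 ≤ b → ∀ z,
      |(1 + m) * softCutoff Λ m * Ψ z * min b M| ≤ CΞ := by
    intro Ψ hΨ0 hΨC m b hm0 hb0 z
    have h1 : 0 ≤ (1 + m) * softCutoff Λ m := mul_nonneg (by linarith) (softCutoff_mem Λ m).1
    have h2 : (1 + m) * softCutoff Λ m ≤ Λ + 2 := one_add_mul_softCutoff_le hΛ hm0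
    have h3 : 0 ≤ min b M := le_min hb0 hM
    rw [abs_of_nonneg (mul_nonneg (mul_nonneg h1 (hΨ0 z)) h3)]
    calc (1 + m) * softCutoff Λ m * Ψ z * min b M ≤ (Λ + 2) * CΦ * M :=
          mul_le_mul (mul_le_mul h2 (hΨC z) (hΨ0 z) (by linarith)) (min_le_right _ _) h3 (by positivity)
      _ = CΞ := rfl
  have hΞbd : ∀ k y, |Ξ k y| ≤ CΞ := fun k y =>
    hweight_bound (hΦ0 k) (hΦC k) (hmk0 k y.1) ((hker.isDiPernaLionsKernel (φ k)).nonneg _ _) _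
  have hΞlbd : ∀ y, |Ξl y| ≤ CΞ := fun y => hweight_bound hΦl0 hΦlC (hml0 y.1) (hB.nonneg _ _) _
  have hΞ0 : ∀ k y, 0 ≤ Ξ k y := fun k y =>
    mul_nonneg (mul_nonneg (mul_nonneg (by linarith [hmk0 k y.1]) (softCutoff_mem Λ _).1) (hΦ0 k _))
      (le_min ((hker.isDiPernaLionsKernel (φ k)).nonneg _ _) hM)
  have hΞl0 : ∀ y, 0 ≤ Ξl y := fun y =>
    mul_nonneg (mul_nonneg (mul_nonneg (by linarith [hml0 y.1]) (softCutoff_mem Λ _).1) (hΦl0 _))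
      (le_min (hB.nonneg _ _) hM)
  have hΞm : ∀ k, Measurable (Ξ k) := by
    intro k
    have h1 : Measurable fun y : (ℝ × E) × ((E × E) × sphere (0 : E) 1) => mk k y.1 := (hmkm k).comp measurable_fst
    exact (((measurable_const.add h1).mul ((continuous_softCutoff Λ).measurable.comp h1)).mul (hΦc k)).mul
      (((hker.isDiPernaLionsKernel (φ k)).measurable.comp measurable_snd).min measurable_const)
  have hΞlm : Measurable Ξl := by
    have h1 : Measurable fun y : (ℝ × E) × ((E × E) × sphere (0 : E) 1) => ml y.1 := hmlm.comp measurable_fst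
    exact (((measurable_const.add h1).mul ((continuous_softCutoff Λ).measurable.comp h1)).mul hΦlc).mul
      ((hB.measurable.comp measurable_snd).min measurable_const)
  -- a.e. convergence of the test weights at the post-collisional partner velocity
  have hΦlim_ν : ∀ᵐ y ∂ν, Tendsto (fun k => Φ k (y.1.1, y.1.2, (collide y.2.2 y.2.1).2)) atTop
      (𝓝 (Φl (y.1.1, y.1.2, (collide y.2.2 y.2.1).2))) := by
    -- first at the velocity `v` itself: pull back along the regrouping
    have h1 : ∀ᵐ y ∂ν, Tendsto (fun k => Φ k (y.1.1, y.1.2, y.2.1.1)) atTop (𝓝 (Φl (y.1.1, y.1.2, y.2.1.1))) := by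
      obtain ⟨e, he⟩ := exists_measurableEquiv_regroup (E := E)
      have hfun : (fun q : (ℝ × E × E) × (E × sphere (0 : E) 1) =>
          (((q.1.1, q.1.2.1) : ℝ × E), (((q.1.2.2, q.2.1) : E × E), q.2.2))) = e := funext fun q => (he q).symm
      have hpres : MeasurePreserving e (μZ.prod ((volume : Measure E).prod (sphereMeasure (E := E)))) ν := by
        rw [← hfun]; exact measurePreserving_regroup _
      rw [← hpres.map_eq, e.measurableEmbedding.ae_map_iff]
      have h2 : ∀ᵐ q ∂(μZ.prod ((volume : Measure E).prod (sphereMeasure (E := E)))),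
          Tendsto (fun k => Φ k q.1) atTop (𝓝 (Φl q.1)) :=
        (Measure.quasiMeasurePreserving_fst (μ := μZ) (ν := (volume : Measure E).prod (sphereMeasure (E := E)))).ae hΦlim
      filter_upwards [h2] with q hq
      simp only [he]
      exact hq
    -- then flip
    have h3 := (measurePreserving_collisionFlip μ₁).quasiMeasurePreserving.ae h1
    filter_upwards [h3] with y hy
    simpa only [Prod.fst_swap] using hy
  -- a.e. convergence of the weights
  have hmass_ν : ∀ᵐ y ∂ν, Tendsto (fun k => mk k y.1) atTop (𝓝 (ml y.1)) := by
    have h1 : ∀ᵐ p ∂μ₁, Tendsto (fun k => mk k p) atTop (𝓝 (ml p)) := by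
      have h := hmass
      rw [baseSlabMeasure_eq_restrict_Ioc_prod] at h
      filter_upwards [h, hae_p] with p hp hmem
      have e1 : ∀ k, mk k p = ∫ ξ, fseq (φ k) p.1 p.2 ξ := fun k => by
        simp only [hmk, hg_eq k p.1 hmem]
        exact integral_congr_ae (ae_of_all _ fun w => abs_of_nonneg ((hsol (φ k)).nonneg _ hmem.1.le _ _))
      have e2 : ml p = ∫ ξ, f p.1 p.2 ξ :=
        integral_congr_ae (ae_of_all _ fun w => abs_of_nonneg (hW.nonneg _ hmem.1.le _ _))
      simp only [e1, e2]
      exact hp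
    exact (Measure.quasiMeasurePreserving_fst (μ := μ₁) (ν := μ₂)).ae h1
  have hker_ν : ∀ᵐ y ∂ν, Tendsto (fun k => Bseq (φ k) y.2.1 y.2.2) atTop (𝓝 (B y.2.1 y.2.2)) := by
    filter_upwards [ae_tendsto_kernelApprox hB hker μ₁] with y hy
    exact hy.comp hW.strictMono.tendsto_atTop
  have hΞlim : ∀ᵐ y ∂ν, Tendsto (fun k => Ξ k y) atTop (𝓝 (Ξl y)) := by
    filter_upwards [hmass_ν, hker_ν, hΦlim_ν] with y hy hB' hΦ'
    have h1 : Tendsto (fun k => (1 + mk k y.1) * softCutoff Λ (mk k y.1)) atTop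
        (𝓝 ((1 + ml y.1) * softCutoff Λ (ml y.1))) :=
      (hy.const_add 1).mul (((continuous_softCutoff Λ).tendsto _).comp hy)
    exact (h1.mul hΦ').mul (hB'.min tendsto_const_nhds)
  -- integrability of the products
  have hPint : ∀ k, Integrable (P k) ν := fun k =>
    integrable_normalisedTensor (hgm k) (fun s hs => by
      refine le_trans (lintegral_mono fun z => ENNReal.ofReal_le_ofReal ?_) (hCg k s hs)
      rw [abs_of_nonneg (hg0 k _ _ _)]
      refine le_mul_of_one_le_right (hg0 k _ _ _) ?_
      nlinarith [sq_nonneg ‖z.1‖, sq_nonneg ‖z.2‖, abs_nonneg (log (g k s z.1 z.2))]) one_pos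
  have hPlint : Integrable Pl ν := integrable_normalisedTensor hW.measurable hCf one_pos
  have hPm : ∀ k, Measurable (P k) := fun k => measurable_normalisedTensor (hgm k) 1
  have hPlm : Measurable Pl := measurable_normalisedTensor hW.measurable 1
  have hP0 : ∀ k y, 0 ≤ P k y := fun k y =>
    mul_nonneg (inv_nonneg.2 (by nlinarith [hmk0 k y.1])) (mul_nonneg (hg0 k _ _ _) (hg0 k _ _ _))
  -- the limit of the pairings
  have hlimit : Tendsto (fun k => ∫ y, P k y * Ξ k y ∂νs) atTop (𝓝 (∫ y, Pl y * Ξl y ∂νs)) := by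
    have h1 : Tendsto (fun k => ∫ y, P k y * Ξl y ∂νs) atTop (𝓝 (∫ y, Pl y * Ξl y ∂νs)) :=
      hweak Ξl CΞ hΞlm.aestronglyMeasurable (ae_of_all _ hΞlbd)
    have h2 : Tendsto (fun k => ∫ y, P k y * (Ξ k y - Ξl y) ∂νs) atTop (𝓝 0) := by
      refine hprod (fun k y => Ξ k y - Ξl y) (CΞ + CΞ) (fun k => (hΞm k).sub hΞlm)
        (fun k y => (abs_sub _ _).trans (add_le_add (hΞbd k y) (hΞlbd y))) ?_
      exact ae_restrict_of_ae (hΞlim.mono fun y hy => tendsto_sub_nhds_zero_iff.2 hy)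
    have heq : ∀ k, ∫ y, P k y * Ξ k y ∂νs = ∫ y, P k y * Ξl y ∂νs + ∫ y, P k y * (Ξ k y - Ξl y) ∂νs := by
      intro k
      have hi1 : Integrable (fun y => P k y * Ξl y) νs :=
        ((hPint k).restrict (s := S)).mul_bdd hΞlm.aestronglyMeasurable (ae_of_all _ fun y =>
          (Real.norm_eq_abs _).le.trans (hΞlbd y))
      have hi2 : Integrable (fun y => P k y * (Ξ k y - Ξl y)) νs :=
        ((hPint k).restrict (s := S)).mul_bdd ((hΞm k).sub hΞlm).aestronglyMeasurable
          (ae_of_all _ fun y => (Real.norm_eq_abs _).le.trans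
            ((abs_sub _ _).trans (add_le_add (hΞbd k y) (hΞlbd y))))
      rw [← integral_add hi1 hi2]
      exact integral_congr_ae (ae_of_all _ fun y => by ring)
    simp only [heq]
    simpa using h1.add h2
  -- identification of the target with the pairing (collision flip)
  have htarget : ∀ k, ∫⁻ y, ENNReal.ofReal (Φ k (y.1.1, y.1.2, y.2.1.1) *
      softCutoff Λ (∫ ξ, clampDensity (fseq (φ k)) (y.1.1, y.1.2, ξ)) *
      ((velBall R₁).indicator (fun p => min (Bseq (φ k) p y.2.2) M) y.2.1 *
        (clampDensity (fseq (φ k)) (y.1.1, y.1.2, (collide y.2.2 y.2.1).1) *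
          clampDensity (fseq (φ k)) (y.1.1, y.1.2, (collide y.2.2 y.2.1).2)))) ∂ν =
      ENNReal.ofReal (∫ y, P k y * Ξ k y ∂νs) := by
    intro k
    have hBk := hker.isDiPernaLionsKernel (φ k)
    -- the integrand before the flip
    set H : (ℝ × E) × ((E × E) × sphere (0 : E) 1) → ℝ≥0∞ := fun y => ENNReal.ofReal (Φ k (y.1.1, y.1.2, y.2.1.1) *
      softCutoff Λ (mk k y.1) * (min (Bseq (φ k) y.2.1 y.2.2) M *
        (g k y.1.1 y.1.2 (collide y.2.2 y.2.1).1 * g k y.1.1 y.1.2 (collide y.2.2 y.2.1).2))) with hH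
    have hHm : Measurable H := by
      have h1 : Measurable fun y : (ℝ × E) × ((E × E) × sphere (0 : E) 1) => mk k y.1 := (hmkm k).comp measurable_fst
      refine ((((hΦm k).comp (measurable_fst.fst.prodMk (measurable_fst.snd.prodMk measurable_snd.fst.fst))).mul
        ((continuous_softCutoff Λ).measurable.comp h1)).mul ((((hBk.measurable.comp measurable_snd).min
        measurable_const)).mul (((hgm k).comp (measurable_fst.fst.prodMk (measurable_fst.snd.prodMk hcol.fst))).mul
        ((hgm k).comp (measurable_fst.fst.prodMk (measurable_fst.snd.prodMk hcol.snd)))))).ennreal_ofReal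
    -- mass as `∫ |g|`
    have hmk_eq : ∀ y : (ℝ × E) × ((E × E) × sphere (0 : E) 1),
        (∫ ξ, g k y.1.1 y.1.2 ξ) = mk k y.1 := fun y => by
      simp only [hmk]
      exact integral_congr_ae (ae_of_all _ fun w => (abs_of_nonneg (hg0 k _ _ _)).symm)
    have hstep1 : ∫⁻ y, ENNReal.ofReal (Φ k (y.1.1, y.1.2, y.2.1.1) *
        softCutoff Λ (∫ ξ, clampDensity (fseq (φ k)) (y.1.1, y.1.2, ξ)) *
        ((velBall R₁).indicator (fun p => min (Bseq (φ k) p y.2.2) M) y.2.1 *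
          (clampDensity (fseq (φ k)) (y.1.1, y.1.2, (collide y.2.2 y.2.1).1) *
            clampDensity (fseq (φ k)) (y.1.1, y.1.2, (collide y.2.2 y.2.1).2)))) ∂ν =
        ∫⁻ y, S.indicator H y ∂ν := by
      refine lintegral_congr fun y => ?_
      simp only [hclamp]
      rw [hmk_eq y]
      by_cases hy : y ∈ S
      · have hy' : y.2.1 ∈ velBall (E := E) R₁ := hy
        rw [indicator_of_mem hy, indicator_of_mem hy']
      · have hy' : y.2.1 ∉ velBall (E := E) R₁ := hy
        rw [indicator_of_notMem hy, indicator_of_notMem hy']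
        simp
    rw [hstep1, lintegral_indicator hSm]
    change ∫⁻ y, H y ∂νs = _
    have hfl := lintegral_shell_eq_lintegral_shell_flip μ₁ R₁ hHm
    rw [← hμ₂, ← hS, ← hν, ← hνs] at hfl
    rw [hfl]
    -- after the flip the integrand is `P Ξ`
    have hflip : ∀ y : (ℝ × E) × ((E × E) × sphere (0 : E) 1),
        H (y.1, ((collide y.2.2 y.2.1).swap, y.2.2)) = ENNReal.ofReal (P k y * Ξ k y) := by
      intro y
      simp only [hH, hP, hΞ]
      rw [hBk.collideSwap_eq, collide_collideSwap]
      simp only [Prod.fst_swap, Prod.snd_swap, one_mul]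
      congr 1
      have hne : (1 + ∫ w, |g k y.1.1 y.1.2 w|) ≠ 0 := by
        have := hmk0 k y.1; simp only [hmk] at this; linarith
      simp only [hmk]
      field_simp
    simp only [hflip]
    have hint : Integrable (fun y => P k y * Ξ k y) νs :=
      ((hPint k).restrict (s := S)).mul_bdd (hΞm k).aestronglyMeasurable
        (ae_of_all _ fun y => (Real.norm_eq_abs _).le.trans (hΞbd k y))
    have hnn : 0 ≤ᵐ[νs] fun y => P k y * Ξ k y := ae_of_all _ fun y => mul_nonneg (hP0 k y) (hΞ0 k y)
    exact (ofReal_integral_eq_lintegral_ofReal hint hnn).symm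
  -- the limit in `[0,∞]` form
  have hlim_eq : ∫⁻ y in S, ENNReal.ofReal (f y.1.1 y.1.2 y.2.1.1 * f y.1.1 y.1.2 y.2.1.2 *
      (softCutoff Λ (∫ ξ, |f y.1.1 y.1.2 ξ|) * Φl (y.1.1, y.1.2, (collide y.2.2 y.2.1).2) * min (B y.2.1 y.2.2) M)) ∂ν =
      ENNReal.ofReal (∫ y, Pl y * Ξl y ∂νs) := by
    have hint : Integrable (fun y => Pl y * Ξl y) νs :=
      (hPlint.restrict (s := S)).mul_bdd hΞlm.aestronglyMeasurable
        (ae_of_all _ fun y => (Real.norm_eq_abs _).le.trans (hΞlbd y))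
    have hnn : 0 ≤ᵐ[νs] fun y => Pl y * Ξl y := by
      filter_upwards [ae_restrict_of_ae (hae_s)] with y hy
      exact mul_nonneg (mul_nonneg (inv_nonneg.2 (by nlinarith [hml0 y.1]))
        (mul_nonneg (hW.nonneg _ hy.1.le _ _) (hW.nonneg _ hy.1.le _ _))) (hΞl0 y)
    rw [ofReal_integral_eq_lintegral_ofReal hint hnn]
    change ∫⁻ y, _ ∂νs = ∫⁻ y, _ ∂νs
    refine lintegral_congr fun y => ?_
    congr 1
    simp only [hPl, hΞl, hml]
    have hne : (1 + ∫ w, |f y.1.1 y.1.2 w|) ≠ 0 := by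
      have := hml0 y.1; simp only [hml] at this; linarith
    field_simp
  rw [hlim_eq]
  simp only [htarget]
  exact ENNReal.tendsto_ofReal hlimit


/-! ## The truncated limits increase to the tested gain term -/

omit [BorelSpace E] in
/-- `softCutoff` is monotone in the localisation level. [folklore] -/
theorem softCutoff_mono_left {Λ Λ' : ℝ} (h : Λ ≤ Λ') (r : ℝ) : softCutoff Λ r ≤ softCutoff Λ' r := by
  unfold softCutoff
  exact min_le_min le_rfl (max_le_max le_rfl (by linarith))

/-- **The truncated limits increase to the full tested gain term** (monotone convergence in the
truncation level `N = M = R₁ = Λ → ∞`, then the collision flip `(v, v_*) ↔ (v', v_*')` and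
Tonelli): `∫_{shell N} f f_* χ_N Φ(c_*) min(B, N) ↑ ∫ Φ Q₊_B(f,f)` in `[0, ∞]`. [cite: CIPDiluteGases1994, §5.3 Step 14 (p. 160)] -/
theorem tendsto_lintegral_truncatedLimit (hB : IsDiPernaLionsKernel B)
    (hfm : Measurable fun z : ℝ × E × E => f z.1 z.2.1 z.2.2) (hf0 : ∀ t ≥ (0 : ℝ), ∀ x v, 0 ≤ f t x v)
    (T : ℝ) {Φl : ℝ × E × E → ℝ} (hΦlm : Measurable Φl) (hΦl0 : ∀ z, 0 ≤ Φl z) :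
    Tendsto (fun N : ℕ => ∫⁻ y in {y : (ℝ × E) × ((E × E) × sphere (0 : E) 1) |
        ‖y.2.1.1‖ ^ 2 + ‖y.2.1.2‖ ^ 2 ≤ (N : ℝ) ^ 2},
        ENNReal.ofReal (f y.1.1 y.1.2 y.2.1.1 * f y.1.1 y.1.2 y.2.1.2 *
          (softCutoff N (∫ ξ, |f y.1.1 y.1.2 ξ|) * Φl (y.1.1, y.1.2, (collide y.2.2 y.2.1).2) *
            min (B y.2.1 y.2.2) N))
        ∂((((volume : Measure ℝ).restrict (Ioc 0 T)).prod (volume : Measure E)).prod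
          (((volume : Measure E).prod volume).prod (sphereMeasure (E := E))))) atTop
      (𝓝 (∫⁻ z, ENNReal.ofReal (Φl z) * eGain B f z
        ∂(((volume : Measure ℝ).restrict (Ioc 0 T)).prod ((volume : Measure E).prod (volume : Measure E))))) := by
  haveI := isFiniteMeasure_sphereMeasure (E := E)
  set μ₁ : Measure (ℝ × E) := ((volume : Measure ℝ).restrict (Ioc 0 T)).prod (volume : Measure E) with hμ₁
  set μ₂ : Measure ((E × E) × sphere (0 : E) 1) :=
    ((volume : Measure E).prod volume).prod (sphereMeasure (E := E)) with hμ₂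
  set ν : Measure ((ℝ × E) × ((E × E) × sphere (0 : E) 1)) := μ₁.prod μ₂ with hν
  have hcol : Measurable fun y : (ℝ × E) × ((E × E) × sphere (0 : E) 1) => collide y.2.2 y.2.1 :=
    continuous_collide_uncurry.measurable.comp (measurable_snd.fst.prodMk measurable_snd.snd)
  have hae_p : ∀ᵐ p ∂μ₁, p.1 ∈ Ioc 0 T :=
    (Measure.quasiMeasurePreserving_fst (μ := (volume : Measure ℝ).restrict (Ioc 0 T))
      (ν := (volume : Measure E))).ae (ae_restrict_mem measurableSet_Ioc)
  have hae_s : ∀ᵐ y ∂ν, y.1.1 ∈ Ioc 0 T := (Measure.quasiMeasurePreserving_fst (μ := μ₁) (ν := μ₂)).ae hae_p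
  -- the integrands
  set G : ℕ → (ℝ × E) × ((E × E) × sphere (0 : E) 1) → ℝ≥0∞ := fun N y =>
    {y : (ℝ × E) × ((E × E) × sphere (0 : E) 1) | ‖y.2.1.1‖ ^ 2 + ‖y.2.1.2‖ ^ 2 ≤ (N : ℝ) ^ 2}.indicator
      (fun y => ENNReal.ofReal (f y.1.1 y.1.2 y.2.1.1 * f y.1.1 y.1.2 y.2.1.2 *
        (softCutoff N (∫ ξ, |f y.1.1 y.1.2 ξ|) * Φl (y.1.1, y.1.2, (collide y.2.2 y.2.1).2) *
          min (B y.2.1 y.2.2) N))) y with hG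
  set Ginf : (ℝ × E) × ((E × E) × sphere (0 : E) 1) → ℝ≥0∞ := fun y =>
    ENNReal.ofReal (Φl (y.1.1, y.1.2, (collide y.2.2 y.2.1).2)) *
      ENNReal.ofReal (B y.2.1 y.2.2 * (f y.1.1 y.1.2 y.2.1.2 * f y.1.1 y.1.2 y.2.1.1)) with hGinf
  have hSm : ∀ N : ℕ, MeasurableSet {y : (ℝ × E) × ((E × E) × sphere (0 : E) 1) |
      ‖y.2.1.1‖ ^ 2 + ‖y.2.1.2‖ ^ 2 ≤ (N : ℝ) ^ 2} := fun N =>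
    measurableSet_le ((measurable_snd.fst.fst.norm.pow_const 2).add (measurable_snd.fst.snd.norm.pow_const 2))
      measurable_const
  have hfv : Measurable fun y : (ℝ × E) × ((E × E) × sphere (0 : E) 1) => f y.1.1 y.1.2 y.2.1.1 :=
    hfm.comp (measurable_fst.fst.prodMk (measurable_fst.snd.prodMk measurable_snd.fst.fst))
  have hfw : Measurable fun y : (ℝ × E) × ((E × E) × sphere (0 : E) 1) => f y.1.1 y.1.2 y.2.1.2 :=
    hfm.comp (measurable_fst.fst.prodMk (measurable_fst.snd.prodMk measurable_snd.fst.snd))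
  have hml : Measurable fun y : (ℝ × E) × ((E × E) × sphere (0 : E) 1) => ∫ ξ, |f y.1.1 y.1.2 ξ| :=
    (measurable_integral_abs_slice hfm).comp measurable_fst
  have hΦc : Measurable fun y : (ℝ × E) × ((E × E) × sphere (0 : E) 1) => Φl (y.1.1, y.1.2, (collide y.2.2 y.2.1).2) :=
    hΦlm.comp (measurable_fst.fst.prodMk (measurable_fst.snd.prodMk hcol.snd))
  have hBm : Measurable fun y : (ℝ × E) × ((E × E) × sphere (0 : E) 1) => B y.2.1 y.2.2 :=
    hB.measurable.comp measurable_snd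
  have hGm : ∀ N, Measurable (G N) := fun N =>
    (((hfv.mul hfw).mul (((((continuous_softCutoff (N : ℝ)).measurable.comp hml).mul hΦc).mul
      (hBm.min measurable_const)))).ennreal_ofReal).indicator (hSm N)
  have hGinfm : Measurable Ginf := hΦc.ennreal_ofReal.mul ((hBm.mul (hfw.mul hfv)).ennreal_ofReal)
  -- the right-hand side as an integral over `ν`
  have hrhs : ∫⁻ z, ENNReal.ofReal (Φl z) * eGain B f z
      ∂(((volume : Measure ℝ).restrict (Ioc 0 T)).prod ((volume : Measure E).prod (volume : Measure E))) =
      ∫⁻ y, Ginf y ∂ν := by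
    rw [lintegral_mul_eGain_eq ((volume : Measure ℝ).restrict (Ioc 0 T)) hB.measurable hfm hΦlm.ennreal_ofReal]
    have hHm : Measurable fun y : (ℝ × E) × ((E × E) × sphere (0 : E) 1) =>
        ENNReal.ofReal (Φl (y.1.1, y.1.2, y.2.1.1)) * ENNReal.ofReal (B y.2.1 y.2.2 *
          (f y.1.1 y.1.2 (collide y.2.2 y.2.1).1 * f y.1.1 y.1.2 (collide y.2.2 y.2.1).2)) :=
      (hΦlm.comp (measurable_fst.fst.prodMk (measurable_fst.snd.prodMk measurable_snd.fst.fst))).ennreal_ofReal.mul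
        ((hBm.mul ((hfm.comp (measurable_fst.fst.prodMk (measurable_fst.snd.prodMk hcol.fst))).mul
          (hfm.comp (measurable_fst.fst.prodMk (measurable_fst.snd.prodMk hcol.snd))))).ennreal_ofReal)
    rw [show ((((volume : Measure ℝ).restrict (Ioc 0 T)).prod (volume : Measure E)).prod
      (((volume : Measure E).prod volume).prod sphereMeasure)) = ν from rfl, lintegral_eq_lintegral_flip μ₁ hHm]
    refine lintegral_congr fun y => ?_
    simp only [hGinf]
    rw [hB.collideSwap_eq, collide_collideSwap]
    simp only [Prod.fst_swap, Prod.snd_swap]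
  rw [hrhs]
  have hlhs : ∀ N : ℕ, ∫⁻ y in {y : (ℝ × E) × ((E × E) × sphere (0 : E) 1) | ‖y.2.1.1‖ ^ 2 + ‖y.2.1.2‖ ^ 2 ≤ (N : ℝ) ^ 2},
      ENNReal.ofReal (f y.1.1 y.1.2 y.2.1.1 * f y.1.1 y.1.2 y.2.1.2 *
        (softCutoff N (∫ ξ, |f y.1.1 y.1.2 ξ|) * Φl (y.1.1, y.1.2, (collide y.2.2 y.2.1).2) *
          min (B y.2.1 y.2.2) N)) ∂ν = ∫⁻ y, G N y ∂ν := fun N => by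
    rw [← lintegral_indicator (hSm N)]
  simp only [hlhs]
  -- monotone convergence
  refine lintegral_tendsto_of_tendsto_of_monotone (fun N => (hGm N).aemeasurable) ?_ ?_
  · filter_upwards [hae_s] with y hy
    intro N N' hNN'
    have hfv0 : 0 ≤ f y.1.1 y.1.2 y.2.1.1 := hf0 _ hy.1.le _ _
    have hfw0 : 0 ≤ f y.1.1 y.1.2 y.2.1.2 := hf0 _ hy.1.le _ _
    have hNN : (N : ℝ) ≤ N' := Nat.cast_le.2 hNN'
    simp only [hG]
    by_cases hmem : y ∈ {y : (ℝ × E) × ((E × E) × sphere (0 : E) 1) | ‖y.2.1.1‖ ^ 2 + ‖y.2.1.2‖ ^ 2 ≤ (N : ℝ) ^ 2}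
    · have hmem' : y ∈ {y : (ℝ × E) × ((E × E) × sphere (0 : E) 1) | ‖y.2.1.1‖ ^ 2 + ‖y.2.1.2‖ ^ 2 ≤ (N' : ℝ) ^ 2} := by
        have h := hmem
        simp only [mem_setOf_eq] at h ⊢
        exact h.trans (pow_le_pow_left₀ (Nat.cast_nonneg _) hNN 2)
      rw [indicator_of_mem hmem, indicator_of_mem hmem']
      refine ENNReal.ofReal_le_ofReal (mul_le_mul_of_nonneg_left ?_ (mul_nonneg hfv0 hfw0))
      have hχ := softCutoff_mono_left hNN (∫ ξ, |f y.1.1 y.1.2 ξ|)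
      have hχ0 := (softCutoff_mem (N : ℝ) (∫ ξ, |f y.1.1 y.1.2 ξ|)).1
      have hmin : min (B y.2.1 y.2.2) (N : ℝ) ≤ min (B y.2.1 y.2.2) N' := min_le_min le_rfl hNN
      have hmin0 : 0 ≤ min (B y.2.1 y.2.2) (N : ℝ) := le_min (hB.nonneg _ _) (Nat.cast_nonneg _)
      have hΦ' := hΦl0 (y.1.1, y.1.2, (collide y.2.2 y.2.1).2)
      exact mul_le_mul (mul_le_mul_of_nonneg_right hχ hΦ') hmin hmin0
        (mul_nonneg (hχ0.trans hχ) hΦ')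
    · rw [indicator_of_notMem hmem]
      exact bot_le
  · filter_upwards [hae_s] with y hy
    -- eventually constant
    obtain ⟨N₀, hN₀⟩ := exists_nat_ge (max (max (∫ ξ, |f y.1.1 y.1.2 ξ|) (B y.2.1 y.2.2))
      (Real.sqrt (‖y.2.1.1‖ ^ 2 + ‖y.2.1.2‖ ^ 2)))
    refine tendsto_atTop_of_eventually_const (i₀ := N₀) fun N hN => ?_
    have hN' : (N₀ : ℝ) ≤ N := Nat.cast_le.2 hN
    have h1 : ∫ ξ, |f y.1.1 y.1.2 ξ| ≤ N := ((le_max_left _ _).trans (le_max_left _ _)).trans (hN₀.trans hN')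
    have h2 : B y.2.1 y.2.2 ≤ N := ((le_max_right _ _).trans (le_max_left _ _)).trans (hN₀.trans hN')
    have h3 : Real.sqrt (‖y.2.1.1‖ ^ 2 + ‖y.2.1.2‖ ^ 2) ≤ N := (le_max_right _ _).trans (hN₀.trans hN')
    have hmem : y ∈ {y : (ℝ × E) × ((E × E) × sphere (0 : E) 1) | ‖y.2.1.1‖ ^ 2 + ‖y.2.1.2‖ ^ 2 ≤ (N : ℝ) ^ 2} := by
      simp only [mem_setOf_eq]
      have h0 : 0 ≤ ‖y.2.1.1‖ ^ 2 + ‖y.2.1.2‖ ^ 2 := by positivity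
      calc ‖y.2.1.1‖ ^ 2 + ‖y.2.1.2‖ ^ 2 = Real.sqrt (‖y.2.1.1‖ ^ 2 + ‖y.2.1.2‖ ^ 2) ^ 2 := (Real.sq_sqrt h0).symm
        _ ≤ (N : ℝ) ^ 2 := pow_le_pow_left₀ (Real.sqrt_nonneg _) h3 2
    simp only [hG, hGinf]
    rw [indicator_of_mem hmem, softCutoff_eq_one h1, min_eq_left h2, one_mul,
      ← ENNReal.ofReal_mul (hΦl0 _)]
    congr 1
    ring


end MainSeq

/-! ## The Duhamel weights of the approximating sequence -/

section Weights

universe u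

variable {E : Type u} [NormedAddCommGroup E] [InnerProductSpace ℝ E] [FiniteDimensional ℝ E]
  [MeasurableSpace E] [BorelSpace E]

variable {B : E × E → sphere (0 : E) 1 → ℝ} {f₀ : E → E → ℝ} {δ : ℕ → ℝ}
  {Bseq : ℕ → E × E → sphere (0 : E) 1 → ℝ} {fseq : ℕ → ℝ → E → E → ℝ} {φ : ℕ → ℕ}
  {f : ℝ → E → E → ℝ}

/-- **The damped Duhamel gain term as a pairing on phase space-time** (Tonelli and the
free-streaming shear, CIP 1994 §5.3 Step 13): for `t`, a measurable set `C` of characteristics and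
an approximate solution `u`,
`∫_C ∫₀ᵗ a♯(s) Q₊(u,u)♯(s) e^{-(Λ♯(t)-Λ♯(s))} ds = ∫ Θ Q₊(u,u)` with the weight
`Θ = duhamelMultiplier t C Λ · a` (`a = (1 + δ'∫u)⁻¹`, time clamped to `[0, ∞)`). [cite: CIPDiluteGases1994, §5.3 Step 13 (p. 157)] -/
theorem setLIntegral_dampedGain_eq_lintegral {δ' : ℝ} (hδ' : 0 ≤ δ') {Bk : E × E → sphere (0 : E) 1 → ℝ}
    (hBk : IsDiPernaLionsKernel Bk) {Cb : ℝ} (hCb : ∀ p ω, Bk p ω ≤ Cb) {u : ℝ → E → E → ℝ}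
    (hu : IsDiPernaLionsApproximateSolution δ' Bk u) (t : ℝ) {C : Set (E × E)} (hC : MeasurableSet C) :
    ∫⁻ z in C, (∫⁻ s in Ioc 0 t, ENNReal.ofReal ((1 + δ' * ∫ w, |u s (z.1 + s • z.2) w|)⁻¹) *
        eGain Bk u (s, z.1 + s • z.2, z.2) *
        ENNReal.ofReal (exp (-(truncatedDampingExponent δ' Bk u t z.1 z.2 -
          truncatedDampingExponent δ' Bk u s z.1 z.2)))) ∂((volume : Measure E).prod volume) =
      ∫⁻ q, ENNReal.ofReal (duhamelMultiplier t C (truncatedDampingExponent δ' Bk u) q *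
          (1 + δ' * ∫ w, |u (max q.1 0) q.2.1 w|)⁻¹) * eGain Bk u q ∂(volume : Measure (ℝ × E × E)) := by
  set Λ : ℝ → E → E → ℝ := truncatedDampingExponent δ' Bk u with hΛ
  have hΛm : Measurable fun a : ℝ × E × E => Λ a.1 a.2.1 a.2.2 := hu.measurable_truncatedDampingExponent hBk.measurable
  set g : ℝ → E → E → ℝ := fun s x v => u (max s 0) x v with hg
  have hgm : Measurable fun z : ℝ × E × E => g z.1 z.2.1 z.2.2 := by
    have hc : Continuous fun z : ℝ × E × E => ((max z.1 0, z.2) : ℝ × E × E) :=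
      (continuous_fst.max continuous_const).prodMk continuous_snd
    exact (hu.continuousOn_uncurry.comp_continuous hc fun z =>
      mk_mem_prod (mem_Ici.2 (le_max_right _ _)) (mem_univ _)).measurable
  have hg_eq : ∀ s, 0 ≤ s → ∀ x v, g s x v = u s x v := fun s hs x v => by simp only [hg, max_eq_left hs]
  have heG : ∀ q : ℝ × E × E, 0 ≤ q.1 → eGain Bk g q = eGain Bk u q := fun q hq => by
    simp only [eGain, hg_eq q.1 hq]
  have hx : Measurable fun q : ℝ × E × E => (q.2.1 - q.1 • q.2.2, q.2.2) :=
    (measurable_snd.fst.sub (measurable_fst.smul measurable_snd.snd)).prodMk measurable_snd.snd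
  set H : ℝ × E × E → ℝ≥0∞ := fun q => ENNReal.ofReal ((1 + δ' * ∫ w, |g q.1 q.2.1 w|)⁻¹) * eGain Bk g q *
      ENNReal.ofReal (exp (-(Λ t (q.2.1 - q.1 • q.2.2) q.2.2 - Λ q.1 (q.2.1 - q.1 • q.2.2) q.2.2))) with hH
  have ham : Measurable fun q : ℝ × E × E => (1 + δ' * ∫ w, |g q.1 q.2.1 w|)⁻¹ :=
    (measurable_const.add (measurable_const.mul (measurable_integral_abs_slice hgm))).inv.comp
      (measurable_fst.prodMk measurable_snd.fst)
  have hHm : Measurable H := by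
    refine (ham.ennreal_ofReal.mul (measurable_eGain hBk.measurable hgm)).mul ?_
    exact (((hΛm.comp (measurable_const.prodMk hx)).sub (hΛm.comp (measurable_fst.prodMk hx))).neg.exp).ennreal_ofReal
  have hL : ∫⁻ z in C, (∫⁻ s in Ioc 0 t, ENNReal.ofReal ((1 + δ' * ∫ w, |u s (z.1 + s • z.2) w|)⁻¹) *
      eGain Bk u (s, z.1 + s • z.2, z.2) * ENNReal.ofReal (exp (-(Λ t z.1 z.2 - Λ s z.1 z.2))))
        ∂((volume : Measure E).prod volume) =
      ∫⁻ z in C, (∫⁻ s in Ioo 0 t, H (s, z.1 + s • z.2, z.2)) ∂((volume : Measure E).prod volume) := by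
    refine lintegral_congr fun z => ?_
    rw [← restrict_Ioo_eq_restrict_Ioc]
    refine setLIntegral_congr_fun measurableSet_Ioo fun s hs => ?_
    simp only [hH, add_sub_cancel_right, hg_eq s hs.1.le, heG (s, z.1 + s • z.2, z.2) hs.1.le]
  rw [hL, setLIntegral_lintegral_Ioo_sharp_eq hHm hC t]
  refine lintegral_congr fun q => ?_
  by_cases hs : q.1 ∈ Ioo 0 t
  · by_cases hz : (q.2.1 - q.1 • q.2.2, q.2.2) ∈ C
    · rw [indicator_of_mem hs, indicator_of_mem hz, one_mul, one_mul]
      have hmono : Λ q.1 (q.2.1 - q.1 • q.2.2) q.2.2 ≤ Λ t (q.2.1 - q.1 • q.2.2) q.2.2 :=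
        hu.truncatedDampingExponent_mono hBk.measurable hBk.nonneg hCb hδ' _ _ hs.1.le hs.2.le
      have hmin : min 1 (exp (-(Λ t (q.2.1 - q.1 • q.2.2) q.2.2 - Λ q.1 (q.2.1 - q.1 • q.2.2) q.2.2))) =
          exp (-(Λ t (q.2.1 - q.1 • q.2.2) q.2.2 - Λ q.1 (q.2.1 - q.1 • q.2.2) q.2.2)) :=
        min_eq_right (by rw [exp_le_one_iff]; linarith)
      have hdm : duhamelMultiplier t C Λ q = exp (-(Λ t (q.2.1 - q.1 • q.2.2) q.2.2 - Λ q.1 (q.2.1 - q.1 • q.2.2) q.2.2)) := by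
        simp only [duhamelMultiplier, indicator_of_mem hs, indicator_of_mem hz, one_mul, hmin]
      have hρ0' : 0 ≤ ∫ w, |g q.1 q.2.1 w| := integral_nonneg fun w => abs_nonneg _
      have ha0 : 0 ≤ (1 + δ' * ∫ w, |g q.1 q.2.1 w|)⁻¹ := inv_nonneg.2 (by nlinarith)
      simp only [hH, hdm, heG q hs.1.le]
      rw [max_eq_left hs.1.le, ENNReal.ofReal_mul (exp_pos _).le]
      simp only [hg, max_eq_left hs.1.le]
      ring
    · have hdm : duhamelMultiplier t C Λ q = 0 := by
        simp only [duhamelMultiplier, indicator_of_notMem hz, zero_mul, mul_zero]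
      rw [indicator_of_notMem hz, zero_mul, mul_zero, hdm, zero_mul, ENNReal.ofReal_zero, zero_mul]
  · have hdm : duhamelMultiplier t C Λ q = 0 := by
      simp only [duhamelMultiplier, indicator_of_notMem hs, zero_mul]
    rw [indicator_of_notMem hs, zero_mul, hdm, zero_mul, ENNReal.ofReal_zero, zero_mul]

omit [FiniteDimensional ℝ E] [MeasurableSpace E] [BorelSpace E] in
/-- **Two-sided difference of the multipliers**: on its support,
`|Mₖ - M| ≤ min(1, |ΔΛ - ΔF|)` for `ΔΛ ≥ 0` (`abs_exp_neg_sub_min_le`). [folklore] -/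
theorem abs_duhamelMultiplier_sub_le {t : ℝ} (C : Set (E × E)) {Λ F : ℝ → E → E → ℝ} {q : ℝ × E × E}
    (hΛ : Λ q.1 (q.2.1 - q.1 • q.2.2) q.2.2 ≤ Λ t (q.2.1 - q.1 • q.2.2) q.2.2) :
    |duhamelMultiplier t C Λ q - duhamelMultiplier t C F q| ≤
      (Ioo 0 t).indicator (fun _ => (1 : ℝ)) q.1 * ((C.indicator (fun _ => (1 : ℝ)) (q.2.1 - q.1 • q.2.2, q.2.2)) *
        min 1 |(Λ t (q.2.1 - q.1 • q.2.2) q.2.2 - Λ q.1 (q.2.1 - q.1 • q.2.2) q.2.2) -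
          (F t (q.2.1 - q.1 • q.2.2) q.2.2 - F q.1 (q.2.1 - q.1 • q.2.2) q.2.2)|) := by
  set a := Λ t (q.2.1 - q.1 • q.2.2) q.2.2 - Λ q.1 (q.2.1 - q.1 • q.2.2) q.2.2 with ha
  set b := F t (q.2.1 - q.1 • q.2.2) q.2.2 - F q.1 (q.2.1 - q.1 • q.2.2) q.2.2 with hb
  have ha0 : 0 ≤ a := sub_nonneg.2 hΛ
  unfold duhamelMultiplier
  rw [← ha, ← hb]
  by_cases hs : q.1 ∈ Ioo 0 t
  · by_cases hz : (q.2.1 - q.1 • q.2.2, q.2.2) ∈ C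
    · rw [indicator_of_mem hs, indicator_of_mem hz]
      simp only [one_mul]
      have hea : min 1 (exp (-a)) = exp (-a) := min_eq_right (by rw [exp_le_one_iff]; linarith)
      rw [hea]
      refine le_min ?_ (abs_exp_neg_sub_min_le ha0)
      have h1 : 0 ≤ exp (-a) ∧ exp (-a) ≤ 1 := ⟨(exp_pos _).le, by rw [exp_le_one_iff]; linarith⟩
      have h2 : 0 ≤ min 1 (exp (-b)) ∧ min 1 (exp (-b)) ≤ 1 := ⟨le_min zero_le_one (exp_pos _).le, min_le_left _ _⟩
      rw [abs_le]; constructor <;> linarith [h1.1, h1.2, h2.1, h2.2]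
    · simp [indicator_of_notMem hz]
  · simp [indicator_of_notMem hs]

/-- **The Duhamel weights of the approximating sequence converge in `L¹`**: with
`Θₙ = duhamelMultiplier t C Λₙ · (1 + δₙ∫fⁿ)⁻¹` and `Θ = duhamelMultiplier t C F`, for
`C ⊆ E × B̄_{R_v}`, `∫ |Θ_{φ(k)} - Θ| → 0` (the damping increments converge,
`lintegral_lintegral_enorm_dampingIncrement_sub_le` with CIP Lemma 5.3.11 ii), and
`1 - (1 + δₙ∫fⁿ)⁻¹ ≤ min(1, δₙ∫fⁿ)` with the mass bound and `δₙ → 0`). [cite: CIPDiluteGases1994, §5.3 Step 13 (p. 157) and Lemma 5.3.11 ii) (p. 155)] -/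
theorem tendsto_lintegral_enorm_duhamelWeight_sub (hB : IsDiPernaLionsKernel B)
    (hf₀ : HasDiPernaLionsData f₀) (hδ : ∀ n, 0 < δ n) (hanti : Antitone δ)
    (hlim : Tendsto δ atTop (𝓝 0)) (hker : IsDiPernaLionsKernelApproximation B Bseq)
    (hdata : IsDiPernaLionsDataApproximation f₀ (fun n => fseq n 0))
    (hsol : ∀ n, IsDiPernaLionsApproximateSolution (δ n) (Bseq n) (fseq n))
    (hbd : UniformDiPernaLionsBounds δ Bseq fseq) (hW : IsDiPernaLionsWeakLimit f₀ fseq φ f) {t : ℝ}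
    (ht : 0 < t) {C : Set (E × E)} {Rv : ℝ} (hCsub : C ⊆ univ ×ˢ closedBall (0 : E) Rv) :
    Tendsto (fun k => ∫⁻ q, ‖duhamelMultiplier t C (truncatedDampingExponent (δ (φ k)) (Bseq (φ k)) (fseq (φ k))) q *
        (1 + δ (φ k) * ∫ w, |fseq (φ k) (max q.1 0) q.2.1 w|)⁻¹ - duhamelMultiplier t C (dampingExponent B f) q‖ₑ
        ∂(volume : Measure (ℝ × E × E))) atTop (𝓝 0) := by
  set F : ℝ → E → E → ℝ := dampingExponent B f with hF
  set box : Set (ℝ × E × E) := Ioo 0 t ×ˢ (univ ×ˢ closedBall (0 : E) Rv) with hbox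
  have hboxm : MeasurableSet box := measurableSet_Ioo.prod (MeasurableSet.univ.prod measurableSet_closedBall)
  -- the mass bound
  obtain ⟨Cm₀, hCm₀⟩ := hbd.massEntropy_le t ht.le
  set Cm : ℝ := max Cm₀ 0 with hCm
  have hCm0 : 0 ≤ Cm := le_max_right _ _
  have hmass : ∀ n, ∀ s ∈ Icc 0 t, ∫⁻ z, ENNReal.ofReal (fseq n s z.1 z.2) ∂((volume : Measure E).prod volume) ≤
      ENNReal.ofReal Cm := by
    intro n s hs
    refine le_trans (lintegral_mono fun z => ENNReal.ofReal_le_ofReal ?_)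
      ((hCm₀ n s hs).trans (ENNReal.ofReal_le_ofReal (le_max_left _ _)))
    refine le_mul_of_one_le_right ((hsol n).nonneg s hs.1 _ _) ?_
    nlinarith [sq_nonneg ‖z.1‖, sq_nonneg ‖z.2‖, abs_nonneg (log (fseq n s z.1 z.2))]
  -- the two vanishing sequences
  set D : ℕ → ℝ≥0∞ := fun k => ∫⁻ q in Ioo 0 t ×ˢ (univ ×ˢ closedBall (0 : E) Rv),
    ‖truncatedCollisionFrequency (δ (φ k)) (Bseq (φ k)) (fseq (φ k)) q.1 q.2.1 q.2.2 -
      DiPernaLionsMildLimit.collisionFrequency B f q.1 q.2.1 q.2.2‖ₑ ∂(volume : Measure (ℝ × E × E)) with hD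
  have hDlim : Tendsto D atTop (𝓝 0) :=
    tendsto_lintegral_box_normalisedFrequency_sub velocityAverage_relativelyCompact_L1_holds hB hf₀
      hδ hanti hlim hker hdata hsol hbd hW t Rv
  set V : ℝ≥0∞ := (volume : Measure E) (closedBall (0 : E) Rv) with hV
  have hVtop : V ≠ ∞ := measure_closedBall_lt_top.ne
  have hδlim : Tendsto (fun k => ENNReal.ofReal (δ (φ k)) * (ENNReal.ofReal t * ENNReal.ofReal Cm * V)) atTop (𝓝 0) := by
    have h1 : Tendsto (fun k => ENNReal.ofReal (δ (φ k))) atTop (𝓝 0) := by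
      have h := ENNReal.tendsto_ofReal (hlim.comp hW.strictMono.tendsto_atTop)
      rwa [ENNReal.ofReal_zero] at h
    have h2 := ENNReal.Tendsto.mul_const h1 (Or.inr (ENNReal.mul_ne_top (ENNReal.mul_ne_top ENNReal.ofReal_ne_top
      ENNReal.ofReal_ne_top) hVtop)) (b := ENNReal.ofReal t * ENNReal.ofReal Cm * V)
    rwa [zero_mul] at h2
  have hsum : Tendsto (fun k => 2 * ENNReal.ofReal t * D k + ENNReal.ofReal (δ (φ k)) *
      (ENNReal.ofReal t * ENNReal.ofReal Cm * V)) atTop (𝓝 0) := by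
    have h1 := ENNReal.Tendsto.const_mul hDlim (Or.inr (ENNReal.mul_ne_top (by simp) ENNReal.ofReal_ne_top))
      (a := 2 * ENNReal.ofReal t)
    rw [mul_zero] at h1
    simpa using h1.add hδlim
  refine tendsto_of_tendsto_of_tendsto_of_le_of_le tendsto_const_nhds hsum (fun k => bot_le) fun k => ?_
  -- ### the bound at level `k`
  have hsolk := hsol (φ k)
  have hBk := hker.isDiPernaLionsKernel (φ k)
  obtain ⟨Cbk, hCbk⟩ := hker.bounded (φ k)
  set Λk : ℝ → E → E → ℝ := truncatedDampingExponent (δ (φ k)) (Bseq (φ k)) (fseq (φ k)) with hΛk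
  have hΛkm : Measurable fun a : ℝ × E × E => Λk a.1 a.2.1 a.2.2 := hsolk.measurable_truncatedDampingExponent hBk.measurable
  have hFm : Measurable fun a : ℝ × E × E => F a.1 a.2.1 a.2.2 := measurable_dampingExponent hB.measurable hW.measurable
  set g : ℝ → E → E → ℝ := fun s x v => fseq (φ k) (max s 0) x v with hg
  have hgm : Measurable fun z : ℝ × E × E => g z.1 z.2.1 z.2.2 := by
    have hc : Continuous fun z : ℝ × E × E => ((max z.1 0, z.2) : ℝ × E × E) :=
      (continuous_fst.max continuous_const).prodMk continuous_snd
    exact (hsolk.continuousOn_uncurry.comp_continuous hc fun z =>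
      mk_mem_prod (mem_Ici.2 (le_max_right _ _)) (mem_univ _)).measurable
  have hg0 : ∀ s x v, 0 ≤ g s x v := fun s x v => hsolk.nonneg _ (le_max_right _ _) _ _
  set ρ : ℝ × E → ℝ := fun p => ∫ w, |g p.1 p.2 w| with hρ
  have hρm : Measurable ρ := measurable_integral_abs_slice hgm
  have hρ0 : ∀ p, 0 ≤ ρ p := fun p => integral_nonneg fun w => abs_nonneg _
  have hx : Measurable fun q : ℝ × E × E => (q.2.1 - q.1 • q.2.2, q.2.2) :=
    (measurable_snd.fst.sub (measurable_fst.smul measurable_snd.snd)).prodMk measurable_snd.snd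
  -- the pointwise bound
  set d₁ : ℝ × E × E → ℝ≥0∞ := fun q => box.indicator (fun q => ‖(Λk t (q.2.1 - q.1 • q.2.2) q.2.2 -
    Λk q.1 (q.2.1 - q.1 • q.2.2) q.2.2) - (F t (q.2.1 - q.1 • q.2.2) q.2.2 - F q.1 (q.2.1 - q.1 • q.2.2) q.2.2)‖ₑ) q with hd₁
  set d₂ : ℝ × E × E → ℝ≥0∞ := fun q => (Ioo 0 t).indicator (fun _ => (1 : ℝ≥0∞)) q.1 *
    ((closedBall (0 : E) Rv).indicator (fun _ => (1 : ℝ≥0∞)) q.2.2 * ENNReal.ofReal (δ (φ k) * ρ (q.1, q.2.1))) with hd₂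
  have hpt : ∀ q, ‖duhamelMultiplier t C Λk q * (1 + δ (φ k) * ∫ w, |fseq (φ k) (max q.1 0) q.2.1 w|)⁻¹ -
      duhamelMultiplier t C F q‖ₑ ≤ d₁ q + d₂ q := by
    intro q
    by_cases hs : q.1 ∈ Ioo 0 t
    swap
    · have h1 : duhamelMultiplier t C Λk q = 0 := by simp only [duhamelMultiplier, indicator_of_notMem hs, zero_mul]
      have h2 : duhamelMultiplier t C F q = 0 := by simp only [duhamelMultiplier, indicator_of_notMem hs, zero_mul]
      rw [h1, h2, zero_mul, sub_zero, enorm_zero]; exact bot_le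
    by_cases hz : (q.2.1 - q.1 • q.2.2, q.2.2) ∈ C
    swap
    · have h1 : duhamelMultiplier t C Λk q = 0 := by
        simp only [duhamelMultiplier, indicator_of_notMem hz, zero_mul, mul_zero]
      have h2 : duhamelMultiplier t C F q = 0 := by
        simp only [duhamelMultiplier, indicator_of_notMem hz, zero_mul, mul_zero]
      rw [h1, h2, zero_mul, sub_zero, enorm_zero]; exact bot_le
    have hqbox : q ∈ box := ⟨hs, mem_univ _, (mem_prod.1 (hCsub hz)).2⟩
    have hv : q.2.2 ∈ closedBall (0 : E) Rv := (mem_prod.1 (hCsub hz)).2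
    set a : ℝ := (1 + δ (φ k) * ∫ w, |fseq (φ k) (max q.1 0) q.2.1 w|)⁻¹ with ha
    have hρq : ρ (q.1, q.2.1) = ∫ w, |fseq (φ k) (max q.1 0) q.2.1 w| := rfl
    have hρq0 : 0 ≤ δ (φ k) * ρ (q.1, q.2.1) := mul_nonneg (hδ _).le (hρ0 _)
    have ha01 : 0 ≤ a ∧ a ≤ 1 := by
      rw [ha, ← hρq]
      exact ⟨inv_nonneg.2 (by linarith), inv_le_one_of_one_le₀ (by linarith)⟩
    have h1a : 1 - a ≤ δ (φ k) * ρ (q.1, q.2.1) := by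
      have hpos : 0 < 1 + δ (φ k) * ρ (q.1, q.2.1) := by linarith
      have hinv : a * (1 + δ (φ k) * ρ (q.1, q.2.1)) = 1 := by
        rw [ha, ← hρq]; exact inv_mul_cancel₀ hpos.ne'
      nlinarith [ha01.1, ha01.2, hρq0, mul_nonneg (sub_nonneg.2 ha01.2) hρq0]
    have hM01 := duhamelMultiplier_mem t C Λk q
    have hmono : Λk q.1 (q.2.1 - q.1 • q.2.2) q.2.2 ≤ Λk t (q.2.1 - q.1 • q.2.2) q.2.2 :=
      hsolk.truncatedDampingExponent_mono hBk.measurable hBk.nonneg hCbk (hδ _).le _ _ hs.1.le hs.2.le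
    have hdiff := abs_duhamelMultiplier_sub_le C (F := F) hmono
    rw [indicator_of_mem hs, indicator_of_mem hz, one_mul, one_mul] at hdiff
    -- `|M a - M'| ≤ M (1 - a) + |M - M'|`
    have hreal : |duhamelMultiplier t C Λk q * a - duhamelMultiplier t C F q| ≤
        |(Λk t (q.2.1 - q.1 • q.2.2) q.2.2 - Λk q.1 (q.2.1 - q.1 • q.2.2) q.2.2) -
          (F t (q.2.1 - q.1 • q.2.2) q.2.2 - F q.1 (q.2.1 - q.1 • q.2.2) q.2.2)| + δ (φ k) * ρ (q.1, q.2.1) := by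
      have hsplit : duhamelMultiplier t C Λk q * a - duhamelMultiplier t C F q =
          (duhamelMultiplier t C Λk q - duhamelMultiplier t C F q) - duhamelMultiplier t C Λk q * (1 - a) := by ring
      rw [hsplit]
      refine (abs_sub _ _).trans (add_le_add (hdiff.trans (min_le_right _ _)) ?_)
      rw [abs_of_nonneg (mul_nonneg hM01.1 (by linarith [ha01.2]))]
      calc duhamelMultiplier t C Λk q * (1 - a) ≤ 1 * (1 - a) :=
            mul_le_mul_of_nonneg_right hM01.2 (by linarith [ha01.2])
        _ ≤ δ (φ k) * ρ (q.1, q.2.1) := by rw [one_mul]; exact h1a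
    simp only [hd₁, hd₂]
    rw [indicator_of_mem hqbox, indicator_of_mem hs, indicator_of_mem hv, one_mul, one_mul, Real.enorm_eq_ofReal_abs,
      Real.enorm_eq_ofReal_abs, ← ENNReal.ofReal_add (abs_nonneg _) hρq0]
    exact ENNReal.ofReal_le_ofReal hreal
  -- integrate
  have hd₁m : Measurable d₁ := by
    refine Measurable.indicator ?_ hboxm
    exact (((hΛkm.comp (measurable_const.prodMk hx)).sub (hΛkm.comp (measurable_fst.prodMk hx))).sub
      ((hFm.comp (measurable_const.prodMk hx)).sub (hFm.comp (measurable_fst.prodMk hx)))).enorm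
  have hI₁ : ∫⁻ q, d₁ q ∂(volume : Measure (ℝ × E × E)) ≤ 2 * ENNReal.ofReal t * D k := by
    simp only [hd₁]
    rw [lintegral_indicator hboxm]
    -- the sheared double integral
    have hhm : Measurable fun q : ℝ × E × E => (Λk t (q.2.1 - q.1 • q.2.2) q.2.2 - Λk q.1 (q.2.1 - q.1 • q.2.2) q.2.2) -
        (F t (q.2.1 - q.1 • q.2.2) q.2.2 - F q.1 (q.2.1 - q.1 • q.2.2) q.2.2) :=
      ((hΛkm.comp (measurable_const.prodMk hx)).sub (hΛkm.comp (measurable_fst.prodMk hx))).sub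
        ((hFm.comp (measurable_const.prodMk hx)).sub (hFm.comp (measurable_fst.prodMk hx)))
    have h3 : ∫⁻ q in box, ‖(Λk t (q.2.1 - q.1 • q.2.2) q.2.2 - Λk q.1 (q.2.1 - q.1 • q.2.2) q.2.2) -
        (F t (q.2.1 - q.1 • q.2.2) q.2.2 - F q.1 (q.2.1 - q.1 • q.2.2) q.2.2)‖ₑ ∂(volume : Measure (ℝ × E × E)) =
        ∫⁻ z in univ ×ˢ closedBall (0 : E) Rv, (∫⁻ s in Ioo 0 t,
          ‖(Λk t z.1 z.2 - Λk s z.1 z.2) - (F t z.1 z.2 - F s z.1 z.2)‖ₑ) ∂((volume : Measure E).prod volume) := by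
      have hL := setLIntegral_lintegral_Ioo_sharp_eq (H := fun q : ℝ × E × E => ‖(Λk t (q.2.1 - q.1 • q.2.2) q.2.2 -
        Λk q.1 (q.2.1 - q.1 • q.2.2) q.2.2) - (F t (q.2.1 - q.1 • q.2.2) q.2.2 - F q.1 (q.2.1 - q.1 • q.2.2) q.2.2)‖ₑ)
        hhm.enorm (MeasurableSet.univ.prod (measurableSet_closedBall (x := (0 : E)) (ε := Rv))) t
      simp only [add_sub_cancel_right] at hL
      rw [hL, ← lintegral_indicator hboxm]
      refine lintegral_congr fun q => ?_
      by_cases hq : q ∈ box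
      · have hs : q.1 ∈ Ioo 0 t := hq.1
        have hv : (q.2.1 - q.1 • q.2.2, q.2.2) ∈ (univ : Set E) ×ˢ closedBall (0 : E) Rv := ⟨mem_univ _, hq.2.2⟩
        rw [indicator_of_mem hq, indicator_of_mem hs, indicator_of_mem hv, one_mul, one_mul]
      · rw [indicator_of_notMem hq]
        by_cases hs : q.1 ∈ Ioo 0 t
        · have hv : (q.2.1 - q.1 • q.2.2, q.2.2) ∉ (univ : Set E) ×ˢ closedBall (0 : E) Rv := by
            intro hv; exact hq ⟨hs, mem_univ _, hv.2⟩
          rw [indicator_of_notMem hv, zero_mul, mul_zero]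
        · rw [indicator_of_notMem hs, zero_mul]
    rw [h3]
    exact lintegral_lintegral_enorm_dampingIncrement_sub_le hB hf₀ hδ hanti hlim hker hdata hsol hbd hW ht.le Rv (φ k)
  have hI₂ : ∫⁻ q, d₂ q ∂(volume : Measure (ℝ × E × E)) ≤
      ENNReal.ofReal (δ (φ k)) * (ENNReal.ofReal t * ENNReal.ofReal Cm * V) := by
    simp only [hd₂]
    -- Tonelli on `ℝ × (E × E)`
    rw [Measure.volume_eq_prod, lintegral_prod _ ?_]
    swap
    · refine (((measurable_const.indicator measurableSet_Ioo).comp measurable_fst).mul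
        (((measurable_const.indicator measurableSet_closedBall).comp measurable_snd.snd).mul
          ((measurable_const.mul (hρm.comp (measurable_fst.prodMk measurable_snd.fst))).ennreal_ofReal))).aemeasurable
    have hinner : ∀ s, ∫⁻ yv : E × E, (Ioo 0 t).indicator (fun _ => (1 : ℝ≥0∞)) s *
        ((closedBall (0 : E) Rv).indicator (fun _ => (1 : ℝ≥0∞)) yv.2 * ENNReal.ofReal (δ (φ k) * ρ (s, yv.1))) =
        (Ioo 0 t).indicator (fun _ => (1 : ℝ≥0∞)) s * (ENNReal.ofReal (δ (φ k)) *
          (∫⁻ y, ENNReal.ofReal (ρ (s, y)) ∂(volume : Measure E)) * V) := by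
      intro s
      have hm1 : Measurable fun yv : E × E => (closedBall (0 : E) Rv).indicator (fun _ => (1 : ℝ≥0∞)) yv.2 *
          ENNReal.ofReal (δ (φ k) * ρ (s, yv.1)) :=
        ((measurable_const.indicator measurableSet_closedBall).comp measurable_snd).mul
          ((measurable_const.mul (hρm.comp (measurable_const.prodMk measurable_fst))).ennreal_ofReal)
      rw [lintegral_const_mul _ hm1]
      congr 1
      rw [Measure.volume_eq_prod]
      have h := lintegral_prod_mul (μ := (volume : Measure E)) (ν := (volume : Measure E))
        (f := fun y => ENNReal.ofReal (δ (φ k) * ρ (s, y))) (g := fun v => (closedBall (0 : E) Rv).indicator (fun _ => (1 : ℝ≥0∞)) v)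
        ((measurable_const.mul (hρm.comp (measurable_const.prodMk measurable_id))).ennreal_ofReal.aemeasurable)
        ((measurable_const.indicator measurableSet_closedBall).aemeasurable)
      rw [show (fun yv : E × E => (closedBall (0 : E) Rv).indicator (fun _ => (1 : ℝ≥0∞)) yv.2 *
          ENNReal.ofReal (δ (φ k) * ρ (s, yv.1))) = fun yv => ENNReal.ofReal (δ (φ k) * ρ (s, yv.1)) *
          (closedBall (0 : E) Rv).indicator (fun _ => (1 : ℝ≥0∞)) yv.2 from funext fun _ => mul_comm _ _, h,
        lintegral_indicator measurableSet_closedBall, setLIntegral_const, one_mul]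
      have hm2 : Measurable fun y : E => ENNReal.ofReal (ρ (s, y)) := (hρm.comp (measurable_const.prodMk measurable_id)).ennreal_ofReal
      rw [← lintegral_const_mul _ hm2]
      congr 1
      exact lintegral_congr fun y => by rw [ENNReal.ofReal_mul (hδ _).le]
    simp only [hinner]
    -- the mass bound for `s ∈ (0, t)`
    have hρint : ∀ s ∈ Ioo 0 t, ∫⁻ y, ENNReal.ofReal (ρ (s, y)) ∂(volume : Measure E) ≤ ENNReal.ofReal Cm := by
      intro s hs
      have h1 : ∀ y, ENNReal.ofReal (ρ (s, y)) ≤ ∫⁻ w, ENNReal.ofReal (g s y w) ∂(volume : Measure E) := by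
        intro y
        simp only [hρ]
        refine (ofReal_integral_le_lintegral_ofReal' _).trans (lintegral_mono fun w => ?_)
        rw [abs_of_nonneg (hg0 s y w)]
      refine (lintegral_mono h1).trans ?_
      have hgsm : Measurable fun z : E × E => ENNReal.ofReal (g s z.1 z.2) :=
        (hgm.comp (measurable_const.prodMk measurable_id)).ennreal_ofReal
      rw [← lintegral_prod _ hgsm.aemeasurable, ← Measure.volume_eq_prod]
      have := hmass (φ k) s ⟨hs.1.le, hs.2.le⟩
      rw [Measure.volume_eq_prod]
      simpa only [hg, max_eq_left hs.1.le] using this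
    calc ∫⁻ s, (Ioo 0 t).indicator (fun _ => (1 : ℝ≥0∞)) s * (ENNReal.ofReal (δ (φ k)) *
          (∫⁻ y, ENNReal.ofReal (ρ (s, y)) ∂(volume : Measure E)) * V) ∂(volume : Measure ℝ)
        ≤ ∫⁻ s, (Ioo 0 t).indicator (fun _ => ENNReal.ofReal (δ (φ k)) * ENNReal.ofReal Cm * V) s ∂(volume : Measure ℝ) := by
          refine lintegral_mono fun s => ?_
          by_cases hs : s ∈ Ioo 0 t
          · rw [indicator_of_mem hs, indicator_of_mem hs, one_mul]
            exact mul_le_mul' (mul_le_mul' le_rfl (hρint s hs)) le_rfl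
          · rw [indicator_of_notMem hs, indicator_of_notMem hs, zero_mul]
      _ = ENNReal.ofReal (δ (φ k)) * (ENNReal.ofReal t * ENNReal.ofReal Cm * V) := by
          rw [lintegral_indicator measurableSet_Ioo, setLIntegral_const, Real.volume_Ioo, sub_zero]; ring
  calc ∫⁻ q, ‖duhamelMultiplier t C Λk q * (1 + δ (φ k) * ∫ w, |fseq (φ k) (max q.1 0) q.2.1 w|)⁻¹ -
        duhamelMultiplier t C F q‖ₑ ∂(volume : Measure (ℝ × E × E))
      ≤ ∫⁻ q, (d₁ q + d₂ q) ∂(volume : Measure (ℝ × E × E)) := lintegral_mono hpt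
    _ = ∫⁻ q, d₁ q ∂(volume : Measure (ℝ × E × E)) + ∫⁻ q, d₂ q ∂(volume : Measure (ℝ × E × E)) :=
        lintegral_add_left hd₁m _
    _ ≤ 2 * ENNReal.ofReal t * D k + ENNReal.ofReal (δ (φ k)) * (ENNReal.ofReal t * ENNReal.ofReal Cm * V) :=
        add_le_add hI₁ hI₂

end Weights


/-! ## The supersolution inequality -/

section Supersolution

universe u

variable {E : Type u} [NormedAddCommGroup E] [InnerProductSpace ℝ E] [FiniteDimensional ℝ E]
  [MeasurableSpace E] [BorelSpace E]

variable {B : E × E → sphere (0 : E) 1 → ℝ} {f₀ : E → E → ℝ} {δ : ℕ → ℝ}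
  {Bseq : ℕ → E × E → sphere (0 : E) 1 → ℝ} {fseq : ℕ → ℝ → E → E → ℝ} {φ : ℕ → ℕ}
  {f : ℝ → E → E → ℝ}

/-- **The data term passes to the limit, lower bound** (companion of
`eventually_setLIntegral_data_le`): for `t ≥ 0`, `C ⊆ E × B̄_{R_v}` and `ε > 0`, eventually
`∫_C f(0) e^{-F♯(t)} ≤ ∫_C f^{φ(k)}(0) e^{-Λₖ♯(t)} + ε` (`F ≥ 0`, `f^{φ(k)}(0) → f(0)` in `L¹`,
`Λₖ♯(t) → F♯(t)` in `L¹(E × B̄_{R_v})`, equi-integrability of `f(0)`). [cite: CIPDiluteGases1994, §5.3 Lemma 5.3.12, proof (p. 158)] -/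
theorem eventually_setLIntegral_data_ge (hB : IsDiPernaLionsKernel B)
    (hf₀ : HasDiPernaLionsData f₀) (hδ : ∀ n, 0 < δ n) (hanti : Antitone δ)
    (hlim : Tendsto δ atTop (𝓝 0)) (hker : IsDiPernaLionsKernelApproximation B Bseq)
    (hdata : IsDiPernaLionsDataApproximation f₀ (fun n => fseq n 0))
    (hsol : ∀ n, IsDiPernaLionsApproximateSolution (δ n) (Bseq n) (fseq n))
    (hbd : UniformDiPernaLionsBounds δ Bseq fseq) (hW : IsDiPernaLionsWeakLimit f₀ fseq φ f) {t : ℝ}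
    (ht : 0 ≤ t) {C : Set (E × E)} {Rv : ℝ}
    (hCsub : C ⊆ univ ×ˢ closedBall (0 : E) Rv) {ε : ℝ} (hε : 0 < ε) :
    ∀ᶠ k in atTop, (∫⁻ z in C, ENNReal.ofReal (f 0 z.1 z.2 * exp (-(dampingExponent B f t z.1 z.2)))
        ∂((volume : Measure E).prod volume)) ≤
      (∫⁻ z in C, ENNReal.ofReal (fseq (φ k) 0 z.1 z.2 *
        exp (-(truncatedDampingExponent (δ (φ k)) (Bseq (φ k)) (fseq (φ k)) t z.1 z.2)))
        ∂((volume : Measure E).prod volume)) + ENNReal.ofReal ε := by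
  set μ : Measure (E × E) := (volume : Measure E).prod volume with hμ
  set F : E × E → ℝ := fun z => dampingExponent B f t z.1 z.2 with hF
  have hFm : Measurable F :=
    (measurable_dampingExponent hB.measurable hW.measurable).comp (measurable_const.prodMk measurable_id)
  have hF0 : ∀ z, 0 ≤ F z := fun z => dampingExponent_nonneg hB.nonneg hW.nonneg t z.1 z.2
  have hf0m : Measurable fun z : E × E => f 0 z.1 z.2 := hW.measurable_slice 0
  have hf00 : ∀ z : E × E, 0 ≤ f 0 z.1 z.2 := fun z => hW.nonneg 0 le_rfl _ _
  obtain ⟨C₀, hC₀⟩ := hW.massEntropy_le 0 le_rfl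
  have hC₀' := hC₀ 0 ⟨le_rfl, le_rfl⟩
  set C₁ : ℝ := max C₀ 0 with hC₁
  have hC₁0 : 0 ≤ C₁ := le_max_right _ _
  have hC₁b : ∫⁻ z, ENNReal.ofReal (f 0 z.1 z.2 * (1 + ‖z.1‖ ^ 2 + ‖z.2‖ ^ 2 + |log (f 0 z.1 z.2)|)) ∂μ ≤
      ENNReal.ofReal C₁ := hC₀'.trans (ENNReal.ofReal_le_ofReal (le_max_left _ _))
  set LR : ℝ := 3 * (C₁ + 1) / ε with hLR
  have hLRpos : 0 < LR := by positivity
  set R' : ℝ := exp LR with hR'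
  have hR'1 : 1 < R' := by rw [hR']; exact Real.one_lt_exp_iff.2 hLRpos
  have hR'pos : 0 < R' := exp_pos _
  have htail : ∫⁻ z in {z | R' < f 0 z.1 z.2}, ENNReal.ofReal (f 0 z.1 z.2) ∂μ ≤ ENNReal.ofReal (ε / 3) := by
    refine (lintegral_tail_le_of_massEntropy_le hf0m hC₁b hR'1).trans (ENNReal.ofReal_le_ofReal ?_)
    rw [hR', log_exp, div_le_iff₀ hLRpos, hLR]
    have : ε / 3 * (3 * (C₁ + 1) / ε) = C₁ + 1 := by field_simp
    rw [this]; linarith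
  have hε3 : (0 : ℝ≥0∞) < ENNReal.ofReal (ε / 3) := ENNReal.ofReal_pos.2 (by positivity)
  have hdat : Tendsto (fun k => ∫⁻ z, ‖fseq (φ k) 0 z.1 z.2 - f 0 z.1 z.2‖ₑ ∂μ) atTop (𝓝 0) := by
    have h := hdata.tendsto_lintegral_sub.comp hW.strictMono.tendsto_atTop
    refine h.congr fun k => lintegral_congr_ae ?_
    filter_upwards [hW.initial_ae] with z hz
    simp only [hz]
  have hΛlim := tendsto_lintegral_enorm_truncatedDampingExponent_sub velocityAverage_relativelyCompact_L1_holds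
    hB hf₀ hδ hanti hlim hker hdata hsol hbd hW (T := t) (t := t) ⟨ht, le_rfl⟩ Rv
  have hev1 : ∀ᶠ k in atTop, ∫⁻ z, ‖fseq (φ k) 0 z.1 z.2 - f 0 z.1 z.2‖ₑ ∂μ < ENNReal.ofReal (ε / 3) :=
    hdat.eventually (gt_mem_nhds hε3)
  have hev2 : ∀ᶠ k in atTop, ENNReal.ofReal R' * ∫⁻ z in univ ×ˢ closedBall (0 : E) Rv,
      ‖truncatedDampingExponent (δ (φ k)) (Bseq (φ k)) (fseq (φ k)) t z.1 z.2 - dampingExponent B f t z.1 z.2‖ₑ ∂μ <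
      ENNReal.ofReal (ε / 3) := by
    have h2 := ENNReal.Tendsto.const_mul hΛlim (Or.inr ENNReal.ofReal_ne_top) (a := ENNReal.ofReal R')
    rw [mul_zero] at h2
    exact h2.eventually (gt_mem_nhds hε3)
  filter_upwards [hev1, hev2] with k hk1 hk2
  have hsolk := hsol (φ k)
  have hBk := hker.isDiPernaLionsKernel (φ k)
  set Λk : E × E → ℝ := fun z => truncatedDampingExponent (δ (φ k)) (Bseq (φ k)) (fseq (φ k)) t z.1 z.2 with hΛk
  have hΛk0 : ∀ z, 0 ≤ Λk z := fun z => truncatedDampingExponent_nonneg hBk.nonneg (hδ _).le hsolk.nonneg t z.1 z.2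
  have hΛkm : Measurable Λk :=
    (hsolk.measurable_truncatedDampingExponent hBk.measurable).comp (measurable_const.prodMk measurable_id)
  have hfk0 : ∀ z : E × E, 0 ≤ fseq (φ k) 0 z.1 z.2 := fun z => hsolk.nonneg 0 le_rfl _ _
  have hfk0m : Measurable fun z : E × E => fseq (φ k) 0 z.1 z.2 := (hsolk.contDiff_slice 0 le_rfl).continuous.measurable
  -- the pointwise bound `b e^{-F} ≤ a e^{-Λ} + |a - b| + R' |Λ - F| + b 1_{b > R'}`
  have hpt : ∀ z : E × E, ENNReal.ofReal (f 0 z.1 z.2 * exp (-(F z))) ≤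
      ENNReal.ofReal (fseq (φ k) 0 z.1 z.2 * exp (-(Λk z))) + ‖fseq (φ k) 0 z.1 z.2 - f 0 z.1 z.2‖ₑ +
        ENNReal.ofReal R' * ‖Λk z - F z‖ₑ +
        {z : E × E | R' < f 0 z.1 z.2}.indicator (fun z => ENNReal.ofReal (f 0 z.1 z.2)) z := by
    intro z
    set a := fseq (φ k) 0 z.1 z.2 with ha
    set b := f 0 z.1 z.2 with hb
    have ha0 : 0 ≤ a := hfk0 z
    have hb0 : 0 ≤ b := hf00 z
    have hexp := exp_neg_le_min_add_min (b := Λk z) (hF0 z)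
    set d := min 1 |F z - Λk z| with hd
    have hd01 : 0 ≤ d ∧ d ≤ 1 := ⟨le_min zero_le_one (abs_nonneg _), min_le_left _ _⟩
    have heΛ : exp (-(Λk z)) ≤ 1 := by rw [exp_le_one_iff]; linarith [hΛk0 z]
    have hmin : min 1 (exp (-(Λk z))) = exp (-(Λk z)) := min_eq_right heΛ
    rw [hmin] at hexp
    have hI : {z : E × E | R' < f 0 z.1 z.2}.indicator (fun z => ENNReal.ofReal (f 0 z.1 z.2)) z =
        ENNReal.ofReal (if R' < b then b else 0) := by
      by_cases hzb : R' < b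
      · rw [indicator_of_mem (show z ∈ {z : E × E | R' < f 0 z.1 z.2} from hzb), if_pos hzb]
      · rw [indicator_of_notMem (show z ∉ {z : E × E | R' < f 0 z.1 z.2} from hzb), if_neg hzb, ENNReal.ofReal_zero]
    have hreal : b * exp (-(F z)) ≤ a * exp (-(Λk z)) + |a - b| + R' * |Λk z - F z| + (if R' < b then b else 0) := by
      have h1 : b * exp (-(F z)) ≤ b * exp (-(Λk z)) + b * d := by nlinarith [hexp, hb0]
      have h2 : b * exp (-(Λk z)) ≤ a * exp (-(Λk z)) + |a - b| := by
        nlinarith [neg_abs_le (a - b), (exp_pos (-(Λk z))).le, heΛ, abs_nonneg (a - b)]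
      have h4 : b * d ≤ R' * |Λk z - F z| + (if R' < b then b else 0) := by
        by_cases hzb : R' < b
        · rw [if_pos hzb]
          have : b * d ≤ b := by nlinarith [hd01.2, hb0]
          nlinarith [abs_nonneg (Λk z - F z), hR'pos.le]
        · rw [if_neg hzb, add_zero]
          rw [not_lt] at hzb
          calc b * d ≤ R' * d := mul_le_mul_of_nonneg_right hzb hd01.1
            _ ≤ R' * |Λk z - F z| := by
                refine mul_le_mul_of_nonneg_left ((min_le_right _ _).trans (le_of_eq (abs_sub_comm _ _))) hR'pos.le
      linarith
    have hi0 : 0 ≤ (if R' < b then b else 0) := by split_ifs <;> linarith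
    have n1 : 0 ≤ a * exp (-(Λk z)) := mul_nonneg ha0 (exp_pos _).le
    have n2 : 0 ≤ |a - b| := abs_nonneg _
    have n3 : 0 ≤ R' * |Λk z - F z| := mul_nonneg hR'pos.le (abs_nonneg _)
    rw [hI, Real.enorm_eq_ofReal_abs, Real.enorm_eq_ofReal_abs, ← ENNReal.ofReal_mul hR'pos.le,
      ← ENNReal.ofReal_add n1 n2, ← ENNReal.ofReal_add (add_nonneg n1 n2) n3,
      ← ENNReal.ofReal_add (add_nonneg (add_nonneg n1 n2) n3) hi0]
    exact ENNReal.ofReal_le_ofReal hreal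
  have hm1 : Measurable fun z : E × E => ENNReal.ofReal (fseq (φ k) 0 z.1 z.2 * exp (-(Λk z))) :=
    (hfk0m.mul hΛkm.neg.exp).ennreal_ofReal
  have hm2 : Measurable fun z : E × E => ‖fseq (φ k) 0 z.1 z.2 - f 0 z.1 z.2‖ₑ := (hfk0m.sub hf0m).enorm
  have hm3 : Measurable fun z : E × E => ENNReal.ofReal R' * ‖Λk z - F z‖ₑ := (hΛkm.sub hFm).enorm.const_mul _
  have hm12 : Measurable fun z : E × E => ENNReal.ofReal (fseq (φ k) 0 z.1 z.2 * exp (-(Λk z))) +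
      ‖fseq (φ k) 0 z.1 z.2 - f 0 z.1 z.2‖ₑ := hm1.add hm2
  have hm123 : Measurable fun z : E × E => ENNReal.ofReal (fseq (φ k) 0 z.1 z.2 * exp (-(Λk z))) +
      ‖fseq (φ k) 0 z.1 z.2 - f 0 z.1 z.2‖ₑ + ENNReal.ofReal R' * ‖Λk z - F z‖ₑ := hm12.add hm3
  have hSm : MeasurableSet {z : E × E | R' < f 0 z.1 z.2} := measurableSet_lt measurable_const hf0m
  calc ∫⁻ z in C, ENNReal.ofReal (f 0 z.1 z.2 * exp (-(F z))) ∂μ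
      ≤ ∫⁻ z in C, (ENNReal.ofReal (fseq (φ k) 0 z.1 z.2 * exp (-(Λk z))) + ‖fseq (φ k) 0 z.1 z.2 - f 0 z.1 z.2‖ₑ +
          ENNReal.ofReal R' * ‖Λk z - F z‖ₑ +
          {z : E × E | R' < f 0 z.1 z.2}.indicator (fun z => ENNReal.ofReal (f 0 z.1 z.2)) z) ∂μ :=
        lintegral_mono fun z => hpt z
    _ = (∫⁻ z in C, ENNReal.ofReal (fseq (φ k) 0 z.1 z.2 * exp (-(Λk z))) ∂μ) +
          (∫⁻ z in C, ‖fseq (φ k) 0 z.1 z.2 - f 0 z.1 z.2‖ₑ ∂μ) +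
          (∫⁻ z in C, ENNReal.ofReal R' * ‖Λk z - F z‖ₑ ∂μ) +
          ∫⁻ z in C, {z : E × E | R' < f 0 z.1 z.2}.indicator (fun z => ENNReal.ofReal (f 0 z.1 z.2)) z ∂μ := by
        rw [lintegral_add_left hm123, lintegral_add_left hm12, lintegral_add_left hm1]
    _ ≤ (∫⁻ z in C, ENNReal.ofReal (fseq (φ k) 0 z.1 z.2 * exp (-(Λk z))) ∂μ) +
          ENNReal.ofReal (ε / 3) + ENNReal.ofReal (ε / 3) + ENNReal.ofReal (ε / 3) := by
        refine add_le_add (add_le_add (add_le_add le_rfl ?_) ?_) ?_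
        · exact (lintegral_mono' Measure.restrict_le_self le_rfl).trans hk1.le
        · refine le_trans ?_ hk2.le
          have hmd : Measurable fun z : E × E => ‖Λk z - F z‖ₑ := (hΛkm.sub hFm).enorm
          rw [lintegral_const_mul _ hmd]
          exact mul_le_mul' le_rfl (lintegral_mono_set hCsub)
        · rw [lintegral_indicator hSm, Measure.restrict_restrict hSm]
          exact (lintegral_mono_set inter_subset_left).trans htail
    _ = _ := by
        rw [add_assoc, add_assoc, ← ENNReal.ofReal_add (by positivity) (by positivity),
          ← ENNReal.ofReal_add (by positivity) (by positivity)]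
        congr 2
        ring

/-- **The exponential form bounds the slice from below by its truncated gain pairing**: for an
index `k` of the sequence, `t > 0`, a measurable set `C` of characteristics and a truncation level
`N`, `∫_C f^{φ(k)}♯(t) ≥ ∫_C f^{φ(k)}(0) e^{-Λₖ♯(t)} + ∫ Θₖ χ_N 1_{shell N} min(Bₖ, N) f^{φ(k)}(v') f^{φ(k)}(v_*')`
in `[0, ∞]` ((3.36) `setLIntegral_dampedGain_eq_lintegral`, `lintegral_mul_eGain_eq`, and dropping
nonnegative terms). [cite: CIPDiluteGases1994, §5.3 Step 13 (3.36) (p. 157)] -/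
theorem setLIntegral_data_add_mainTerm_le_sharp (hδ : ∀ n, 0 < δ n)
    (hker : IsDiPernaLionsKernelApproximation B Bseq)
    (hsol : ∀ n, IsDiPernaLionsApproximateSolution (δ n) (Bseq n) (fseq n)) (φ : ℕ → ℕ) {t : ℝ}
    (ht : 0 < t) {C : Set (E × E)} (hC : MeasurableSet C) (N : ℕ) (k : ℕ) :
    (∫⁻ z in C, ENNReal.ofReal (fseq (φ k) 0 z.1 z.2 *
        exp (-(truncatedDampingExponent (δ (φ k)) (Bseq (φ k)) (fseq (φ k)) t z.1 z.2)))
        ∂((volume : Measure E).prod volume)) +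
      ∫⁻ y, ENNReal.ofReal ((duhamelMultiplier t C (truncatedDampingExponent (δ (φ k)) (Bseq (φ k)) (fseq (φ k)))
            (y.1.1, y.1.2, y.2.1.1) * (1 + δ (φ k) * ∫ w, |fseq (φ k) (max y.1.1 0) y.1.2 w|)⁻¹) *
          softCutoff N (∫ ξ, clampDensity (fseq (φ k)) (y.1.1, y.1.2, ξ)) *
          ((velBall (N : ℝ)).indicator (fun p => min (Bseq (φ k) p y.2.2) (N : ℝ)) y.2.1 *
            (clampDensity (fseq (φ k)) (y.1.1, y.1.2, (collide y.2.2 y.2.1).1) *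
              clampDensity (fseq (φ k)) (y.1.1, y.1.2, (collide y.2.2 y.2.1).2))))
        ∂((((volume : Measure ℝ).restrict (Ioc 0 t)).prod (volume : Measure E)).prod
          (((volume : Measure E).prod volume).prod (sphereMeasure (E := E)))) ≤
      ∫⁻ z in C, ENNReal.ofReal (fseq (φ k) t (z.1 + t • z.2) z.2) ∂((volume : Measure E).prod volume) := by
  haveI := isFiniteMeasure_sphereMeasure (E := E)
  set μ : Measure (E × E) := (volume : Measure E).prod volume with hμ
  have hsolk := hsol (φ k)
  have hBk := hker.isDiPernaLionsKernel (φ k)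
  obtain ⟨Cbk, hCbk⟩ := hker.bounded (φ k)
  obtain ⟨Rbk, hRbk⟩ := hker.eq_zero_of_le (φ k)
  set Λk : ℝ → E → E → ℝ := truncatedDampingExponent (δ (φ k)) (Bseq (φ k)) (fseq (φ k)) with hΛk
  have hΛkm : Measurable fun a : ℝ × E × E => Λk a.1 a.2.1 a.2.2 := hsolk.measurable_truncatedDampingExponent hBk.measurable
  have hΛkt : Measurable fun z : E × E => Λk t z.1 z.2 := hΛkm.comp (measurable_const.prodMk measurable_id)
  set g : ℝ → E → E → ℝ := fun s x v => fseq (φ k) (max s 0) x v with hg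
  have hgm : Measurable fun z : ℝ × E × E => g z.1 z.2.1 z.2.2 := by
    have hc : Continuous fun z : ℝ × E × E => ((max z.1 0, z.2) : ℝ × E × E) :=
      (continuous_fst.max continuous_const).prodMk continuous_snd
    exact (hsolk.continuousOn_uncurry.comp_continuous hc fun z =>
      mk_mem_prod (mem_Ici.2 (le_max_right _ _)) (mem_univ _)).measurable
  have hg0 : ∀ s x v, 0 ≤ g s x v := fun s x v => hsolk.nonneg _ (le_max_right _ _) _ _
  -- (3.36) integrated over `C`
  have hm0 : Measurable fun z : E × E => ENNReal.ofReal (fseq (φ k) 0 z.1 z.2 * exp (-(Λk t z.1 z.2))) :=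
    (((hsolk.contDiff_slice 0 le_rfl).continuous.measurable).mul hΛkt.neg.exp).ennreal_ofReal
  have hexp : ∫⁻ z in C, ENNReal.ofReal (fseq (φ k) t (z.1 + t • z.2) z.2) ∂μ =
      (∫⁻ z in C, ENNReal.ofReal (fseq (φ k) 0 z.1 z.2 * exp (-(Λk t z.1 z.2))) ∂μ) +
      ∫⁻ z in C, (∫⁻ s in Ioc 0 t, ENNReal.ofReal ((1 + δ (φ k) * ∫ w, |fseq (φ k) s (z.1 + s • z.2) w|)⁻¹) *
        eGain (Bseq (φ k)) (fseq (φ k)) (s, z.1 + s • z.2, z.2) *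
        ENNReal.ofReal (exp (-(Λk t z.1 z.2 - Λk s z.1 z.2)))) ∂μ := by
    rw [← lintegral_add_left hm0]
    exact lintegral_congr fun z => hsolk.ofReal_sharp_eq_lintegral hBk hCbk hRbk (hδ _).le t ht.le z.1 z.2
  rw [hexp, setLIntegral_dampedGain_eq_lintegral (hδ (φ k)).le hBk hCbk hsolk t hC]
  refine add_le_add le_rfl ?_
  -- the weight
  set Θ : ℝ × E × E → ℝ := fun q => duhamelMultiplier t C Λk q * (1 + δ (φ k) * ∫ w, |fseq (φ k) (max q.1 0) q.2.1 w|)⁻¹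
    with hΘ
  have ham : Measurable fun q : ℝ × E × E => (1 + δ (φ k) * ∫ w, |fseq (φ k) (max q.1 0) q.2.1 w|)⁻¹ :=
    (measurable_const.add (measurable_const.mul (measurable_integral_abs_slice hgm))).inv.comp
      (measurable_fst.prodMk measurable_snd.fst)
  have hΘm : Measurable Θ := (measurable_duhamelMultiplier t hC hΛkm).mul ham
  have ha01 : ∀ q : ℝ × E × E, 0 ≤ (1 + δ (φ k) * ∫ w, |fseq (φ k) (max q.1 0) q.2.1 w|)⁻¹ ∧
      (1 + δ (φ k) * ∫ w, |fseq (φ k) (max q.1 0) q.2.1 w|)⁻¹ ≤ 1 := by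
    intro q
    have hm0 : 0 ≤ ∫ w, |fseq (φ k) (max q.1 0) q.2.1 w| := integral_nonneg fun _ => abs_nonneg _
    have h1 : 1 ≤ 1 + δ (φ k) * ∫ w, |fseq (φ k) (max q.1 0) q.2.1 w| := by nlinarith [(hδ (φ k)).le]
    exact ⟨inv_nonneg.2 (by linarith), inv_le_one_of_one_le₀ h1⟩
  have hΘ01 : ∀ q, 0 ≤ Θ q ∧ Θ q ≤ 1 := fun q =>
    ⟨mul_nonneg (duhamelMultiplier_mem t C Λk q).1 (ha01 q).1,
      (mul_le_mul (duhamelMultiplier_mem t C Λk q).2 (ha01 q).2 (ha01 q).1 zero_le_one).trans (one_mul _).le⟩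
  -- replace the density by its clamped version (the weight lives on `s ∈ (0, t)`)
  have hclamp : ∀ q : ℝ × E × E, ENNReal.ofReal (Θ q) * eGain (Bseq (φ k)) (fseq (φ k)) q =
      ENNReal.ofReal (Θ q) * eGain (Bseq (φ k)) g q := by
    intro q
    by_cases hq : duhamelMultiplier t C Λk q = 0
    · simp [hΘ, hq]
    · obtain ⟨hs, -⟩ := mem_of_duhamelMultiplier_ne_zero hq
      simp only [eGain, hg, max_eq_left hs.1.le]
  simp only [show ∀ q : ℝ × E × E, duhamelMultiplier t C Λk q * (1 + δ (φ k) * ∫ w, |fseq (φ k) (max q.1 0) q.2.1 w|)⁻¹ = Θ q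
    from fun q => rfl]
  rw [lintegral_congr hclamp]
  -- restrict the time variable to `(0, t]`
  set μZ : Measure (ℝ × E × E) := ((volume : Measure ℝ).restrict (Ioc 0 t)).prod
    ((volume : Measure E).prod (volume : Measure E)) with hμZ
  have hle : μZ ≤ (volume : Measure (ℝ × E × E)) := by
    rw [hμZ, Measure.volume_eq_prod, Measure.volume_eq_prod]
    exact Measure.prod_mono Measure.restrict_le_self le_rfl
  refine le_trans ?_ (lintegral_mono' hle le_rfl)
  rw [lintegral_mul_eGain_eq ((volume : Measure ℝ).restrict (Ioc 0 t)) hBk.measurable hgm hΘm.ennreal_ofReal]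
  -- drop the truncations
  refine lintegral_mono fun y => ?_
  have hΘy := hΘ01 (y.1.1, y.1.2, y.2.1.1)
  have hχ := softCutoff_mem (N : ℝ) (∫ ξ, clampDensity (fseq (φ k)) (y.1.1, y.1.2, ξ))
  have hgg : 0 ≤ clampDensity (fseq (φ k)) (y.1.1, y.1.2, (collide y.2.2 y.2.1).1) *
      clampDensity (fseq (φ k)) (y.1.1, y.1.2, (collide y.2.2 y.2.1).2) :=
    mul_nonneg (hg0 _ _ _) (hg0 _ _ _)
  have hind : 0 ≤ (velBall (N : ℝ)).indicator (fun p => min (Bseq (φ k) p y.2.2) (N : ℝ)) y.2.1 ∧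
      (velBall (N : ℝ)).indicator (fun p => min (Bseq (φ k) p y.2.2) (N : ℝ)) y.2.1 ≤ Bseq (φ k) y.2.1 y.2.2 := by
    by_cases hp : y.2.1 ∈ velBall (N : ℝ)
    · rw [indicator_of_mem hp]
      exact ⟨le_min (hBk.nonneg _ _) (Nat.cast_nonneg _), min_le_left _ _⟩
    · rw [indicator_of_notMem hp]
      exact ⟨le_rfl, hBk.nonneg _ _⟩
  rw [← ENNReal.ofReal_mul hΘy.1]
  refine ENNReal.ofReal_le_ofReal ?_
  have h1 : Θ (y.1.1, y.1.2, y.2.1.1) * softCutoff N (∫ ξ, clampDensity (fseq (φ k)) (y.1.1, y.1.2, ξ)) ≤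
      Θ (y.1.1, y.1.2, y.2.1.1) := mul_le_of_le_one_right hΘy.1 hχ.2
  calc Θ (y.1.1, y.1.2, y.2.1.1) * softCutoff N (∫ ξ, clampDensity (fseq (φ k)) (y.1.1, y.1.2, ξ)) *
        ((velBall (N : ℝ)).indicator (fun p => min (Bseq (φ k) p y.2.2) (N : ℝ)) y.2.1 *
          (clampDensity (fseq (φ k)) (y.1.1, y.1.2, (collide y.2.2 y.2.1).1) *
            clampDensity (fseq (φ k)) (y.1.1, y.1.2, (collide y.2.2 y.2.1).2)))
      ≤ Θ (y.1.1, y.1.2, y.2.1.1) * (Bseq (φ k) y.2.1 y.2.2 *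
          (clampDensity (fseq (φ k)) (y.1.1, y.1.2, (collide y.2.2 y.2.1).1) *
            clampDensity (fseq (φ k)) (y.1.1, y.1.2, (collide y.2.2 y.2.1).2))) :=
        mul_le_mul h1 (mul_le_mul_of_nonneg_right hind.2 hgg) (mul_nonneg hind.1 hgg) hΘy.1
    _ = _ := by simp only [clampDensity, hg]


/-- **The tested limit multiplier reproduces the damped gain primitive from above a.e.**: for
a.e. characteristic the limit damping exponent is monotone in time ((Lb) and
`ae_integrableOn_collisionFrequency_sharp`), so `min(1, e^{-(F♯(t)-F♯(s))}) = e^{-(F♯(t)-F♯(s))}`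
and `∫_C (T_F⁻¹Q₊(f,f))♯(t) = ∫ Θ Q₊_B(f,f)` over `(0,t] × E × E` with
`Θ = duhamelMultiplier t C F`. [cite: CIPDiluteGases1994, §5.3 Step 13 (p. 157)] -/
theorem IsDiPernaLionsWeakLimit.setLIntegral_eDampedGainPrimitive_le (hW : IsDiPernaLionsWeakLimit f₀ fseq φ f)
    (hB : IsDiPernaLionsKernel B) (hf₀ : HasDiPernaLionsData f₀) (hδ : ∀ n, 0 < δ n) (hanti : Antitone δ)
    (hlim : Tendsto δ atTop (𝓝 0)) (hker : IsDiPernaLionsKernelApproximation B Bseq)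
    (hdata : IsDiPernaLionsDataApproximation f₀ (fun n => fseq n 0))
    (hsol : ∀ n, IsDiPernaLionsApproximateSolution (δ n) (Bseq n) (fseq n))
    (hbd : UniformDiPernaLionsBounds δ Bseq fseq) (t : ℝ) {C : Set (E × E)} (hC : MeasurableSet C) :
    ∫⁻ z in C, eDampedGainPrimitive B f t z.1 z.2 ∂((volume : Measure E).prod volume) ≤
      ∫⁻ q, ENNReal.ofReal (duhamelMultiplier t C (dampingExponent B f) q) * eGain B f q
        ∂(((volume : Measure ℝ).restrict (Ioc 0 t)).prod ((volume : Measure E).prod (volume : Measure E))) := by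
  set μ : Measure (E × E) := (volume : Measure E).prod volume with hμ
  set F : ℝ → E → E → ℝ := dampingExponent B f with hF
  have hFm : Measurable fun a : ℝ × E × E => F a.1 a.2.1 a.2.2 := measurable_dampingExponent hB.measurable hW.measurable
  -- a.e. monotonicity of the damping exponent along characteristics
  have hLb := diPernaLions_limit_collisionFrequency_bound_holds hB hf₀ hδ hanti hlim hker hdata hsol hbd hW
  have hae := ae_integrableOn_collisionFrequency_sharp hB.measurable hB.nonneg hW.measurable hW.nonneg hLb
  have hx : Measurable fun q : ℝ × E × E => (q.2.1 - q.1 • q.2.2, q.2.2) :=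
    (measurable_snd.fst.sub (measurable_fst.smul measurable_snd.snd)).prodMk measurable_snd.snd
  set H : ℝ × E × E → ℝ≥0∞ := fun q => ENNReal.ofReal (min 1 (exp (-(F t (q.2.1 - q.1 • q.2.2) q.2.2 -
    F q.1 (q.2.1 - q.1 • q.2.2) q.2.2)))) * eGain B f q with hH
  have hHm : Measurable H :=
    (measurable_const.min ((hFm.comp (measurable_const.prodMk hx)).sub (hFm.comp (measurable_fst.prodMk hx))).neg.exp).ennreal_ofReal.mul
      (measurable_eGain hB.measurable hW.measurable)
  -- step 1: a.e. in `z`, the primitive is the sheared inner integral with the capped weight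
  have hstep1 : ∫⁻ z in C, eDampedGainPrimitive B f t z.1 z.2 ∂μ = ∫⁻ z in C, (∫⁻ s in Ioo 0 t, H (s, z.1 + s • z.2, z.2)) ∂μ := by
    refine setLIntegral_congr_fun_ae hC ?_
    filter_upwards [hae] with z hz _
    rw [eDampedGainPrimitive_apply, ← restrict_Ioo_eq_restrict_Ioc]
    refine setLIntegral_congr_fun measurableSet_Ioo fun s hs => ?_
    have hmono : F s z.1 z.2 ≤ F t z.1 z.2 :=
      dampingExponent_mono hB.nonneg hW.nonneg hs.2.le ((hz t).mono_set Ioc_subset_Icc_self)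
    have hmin : min 1 (exp (-(F t z.1 z.2 - F s z.1 z.2))) = exp (-(F t z.1 z.2 - F s z.1 z.2)) :=
      min_eq_right (by rw [exp_le_one_iff]; linarith)
    simp only [hH, add_sub_cancel_right, hmin]
    rw [mul_comm]
  rw [hstep1, setLIntegral_lintegral_Ioo_sharp_eq hHm hC t]
  -- step 2: the pairing over `ℝ × E × E` equals the pairing over `(0,t] × E × E`
  have h1 : ∀ q, (Ioo 0 t).indicator (fun _ => (1 : ℝ≥0∞)) q.1 * (C.indicator (fun _ => (1 : ℝ≥0∞)) (q.2.1 - q.1 • q.2.2, q.2.2) * H q) =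
      ENNReal.ofReal (duhamelMultiplier t C F q) * eGain B f q := by
    intro q
    simp only [hH, duhamelMultiplier]
    by_cases hs : q.1 ∈ Ioo 0 t
    · by_cases hz : (q.2.1 - q.1 • q.2.2, q.2.2) ∈ C
      · simp [indicator_of_mem hs, indicator_of_mem hz]
      · simp [indicator_of_notMem hz]
    · simp [indicator_of_notMem hs]
  simp only [h1]
  -- the integrand vanishes off `(0,t] × E × E`
  have hsupp : ∀ q : ℝ × E × E, ENNReal.ofReal (duhamelMultiplier t C F q) * eGain B f q =
      (Ioc 0 t ×ˢ (univ : Set (E × E))).indicator (fun q => ENNReal.ofReal (duhamelMultiplier t C F q) * eGain B f q) q := by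
    intro q
    by_cases hq : q ∈ Ioc 0 t ×ˢ (univ : Set (E × E))
    · rw [indicator_of_mem hq]
    · rw [indicator_of_notMem hq]
      have hdm : duhamelMultiplier t C F q = 0 := by
        by_contra hne
        exact hq ⟨Ioo_subset_Ioc_self (mem_of_duhamelMultiplier_ne_zero hne).1, mem_univ _⟩
      rw [hdm, ENNReal.ofReal_zero, zero_mul]
  have hrestr : (((volume : Measure ℝ).restrict (Ioc 0 t)).prod ((volume : Measure E).prod (volume : Measure E))) =
      (volume : Measure (ℝ × E × E)).restrict (Ioc 0 t ×ˢ (univ : Set (E × E))) := by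
    rw [Measure.volume_eq_prod, Measure.volume_eq_prod, ← Measure.prod_restrict, Measure.restrict_univ]
  rw [hrestr, ← lintegral_indicator (measurableSet_Ioc.prod MeasurableSet.univ)]
  exact le_of_eq (lintegral_congr hsupp)

/-- **The supersolution inequality on a set of characteristics** (CIP 1994 §5.3 Lemma 5.3.12,
(3.38)–(3.40), p. 158: "`f ≥ f₀ e^{-F} + T_F⁻¹ Q₊(f,f)`", here integrated over a measurable set
`C ⊆ E × B̄_{R_v}` of characteristics): for `t > 0`,
`∫_C (f(0) e^{-F♯(t)} + (T_F⁻¹Q₊(f,f))♯(t)) ≤ ∫_C f♯(t)`. Proof (in the tree's DiPerna–Lions generality,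
replacing CIP's truncations `gₘⁿ` by the level/shell/kernel truncations of the main-term lemma):
the exponential form (3.36) bounds `∫_C f^{φ(k)}♯(t)` from below by the data term plus the pairing of
the Duhamel weights `Θₖ` with the truncated post-collisional products
(`setLIntegral_data_add_mainTerm_le_sharp`); along a subsequence with a.e. convergent velocity
masses (CIP Lemma 5.3.11 i)) and a.e. convergent weights (`tendsto_lintegral_enorm_duhamelWeight_sub`)
the pairings converge by velocity averaging (`tendsto_lintegral_mainTerm_seq`), the data terms
converge (`eventually_setLIntegral_data_ge`) and `∫_C f^{φ(k)}♯(t) → ∫_C f♯(t)`; the truncation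
levels are removed by monotone convergence (`tendsto_lintegral_truncatedLimit`) and the limit
pairing dominates `∫_C (T_F⁻¹Q₊(f,f))♯(t)` (`setLIntegral_eDampedGainPrimitive_le`). [cite: CIPDiluteGases1994, §5.3 Lemma 5.3.12, proof (3.38)–(3.40) (p. 158)] -/
theorem IsDiPernaLionsWeakLimit.setLIntegral_sharp_ge (hW : IsDiPernaLionsWeakLimit f₀ fseq φ f)
    (hB : IsDiPernaLionsKernel B) (hf₀ : HasDiPernaLionsData f₀) (hδ : ∀ n, 0 < δ n) (hanti : Antitone δ)
    (hlim : Tendsto δ atTop (𝓝 0)) (hker : IsDiPernaLionsKernelApproximation B Bseq)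
    (hdata : IsDiPernaLionsDataApproximation f₀ (fun n => fseq n 0))
    (hsol : ∀ n, IsDiPernaLionsApproximateSolution (δ n) (Bseq n) (fseq n))
    (hbd : UniformDiPernaLionsBounds δ Bseq fseq) {t : ℝ} (ht : 0 < t) {C : Set (E × E)}
    (hC : MeasurableSet C) {Rv : ℝ} (hCsub : C ⊆ univ ×ˢ closedBall (0 : E) Rv) :
    ∫⁻ z in C, (ENNReal.ofReal (f 0 z.1 z.2 * exp (-(dampingExponent B f t z.1 z.2))) +
        eDampedGainPrimitive B f t z.1 z.2) ∂((volume : Measure E).prod volume) ≤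
      ∫⁻ z in C, ENNReal.ofReal (f t (z.1 + t • z.2) z.2) ∂((volume : Measure E).prod volume) := by
  haveI := isFiniteMeasure_sphereMeasure (E := E)
  set μ : Measure (E × E) := (volume : Measure E).prod volume with hμ
  set F : ℝ → E → E → ℝ := dampingExponent B f with hF
  have hFm : Measurable fun a : ℝ × E × E => F a.1 a.2.1 a.2.2 := measurable_dampingExponent hB.measurable hW.measurable
  set Θl : ℝ × E × E → ℝ := duhamelMultiplier t C F with hΘl
  have hΘlm : Measurable Θl := measurable_duhamelMultiplier t hC hFm
  have hΘl01 : ∀ q, 0 ≤ Θl q ∧ Θl q ≤ 1 := duhamelMultiplier_mem t C F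
  -- the weights of the sequence
  set Θn : ℕ → ℝ × E × E → ℝ := fun n q =>
    duhamelMultiplier t C (truncatedDampingExponent (δ n) (Bseq n) (fseq n)) q *
      (1 + δ n * ∫ w, |fseq n (max q.1 0) q.2.1 w|)⁻¹ with hΘn
  have hgm : ∀ n, Measurable fun z : ℝ × E × E => fseq n (max z.1 0) z.2.1 z.2.2 := by
    intro n
    have hc : Continuous fun z : ℝ × E × E => ((max z.1 0, z.2) : ℝ × E × E) :=
      (continuous_fst.max continuous_const).prodMk continuous_snd
    exact ((hsol n).continuousOn_uncurry.comp_continuous hc fun z =>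
      mk_mem_prod (mem_Ici.2 (le_max_right _ _)) (mem_univ _)).measurable
  have hΘnm : ∀ n, Measurable (Θn n) := by
    intro n
    refine (measurable_duhamelMultiplier t hC ((hsol n).measurable_truncatedDampingExponent
      (hker.isDiPernaLionsKernel n).measurable)).mul ?_
    exact (measurable_const.add (measurable_const.mul (measurable_integral_abs_slice
      (g := fun s x v => fseq n (max s 0) x v) (hgm n)))).inv.comp (measurable_fst.prodMk measurable_snd.fst)
  have hΘn01 : ∀ n q, 0 ≤ Θn n q ∧ Θn n q ≤ 1 := by
    intro n q
    have hm0 : 0 ≤ ∫ w, |fseq n (max q.1 0) q.2.1 w| := integral_nonneg fun _ => abs_nonneg _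
    have h1 : 1 ≤ 1 + δ n * ∫ w, |fseq n (max q.1 0) q.2.1 w| := by nlinarith [(hδ n).le]
    have ha01 : 0 ≤ (1 + δ n * ∫ w, |fseq n (max q.1 0) q.2.1 w|)⁻¹ ∧ (1 + δ n * ∫ w, |fseq n (max q.1 0) q.2.1 w|)⁻¹ ≤ 1 :=
      ⟨inv_nonneg.2 (by linarith), inv_le_one_of_one_le₀ h1⟩
    have hd := duhamelMultiplier_mem t C (truncatedDampingExponent (δ n) (Bseq n) (fseq n)) q
    exact ⟨mul_nonneg hd.1 ha01.1, (mul_le_mul hd.2 ha01.2 ha01.1 zero_le_one).trans (one_mul _).le⟩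
  -- ### step 1: a subsequence with a.e. convergent velocity masses and weights
  obtain ⟨ψ₁, hψ₁, hmass₁⟩ := exists_subseq_velocityMass_tendsto_ae velocityAverage_relativelyCompact_L1_holds
    hB hf₀ hδ hanti hlim hker hdata hsol hbd hW
  have hW₁ : IsDiPernaLionsWeakLimit f₀ fseq (φ ∘ ψ₁) f := hW.comp_strictMono hψ₁
  have hL1 : Tendsto (fun j => ∫⁻ q, ‖Θn ((φ ∘ ψ₁) j) q - Θl q‖ₑ ∂(volume : Measure (ℝ × E × E))) atTop (𝓝 0) :=
    tendsto_lintegral_enorm_duhamelWeight_sub hB hf₀ hδ hanti hlim hker hdata hsol hbd hW₁ ht hCsub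
  have hTIM : TendstoInMeasure (volume : Measure (ℝ × E × E)) (fun j => Θn ((φ ∘ ψ₁) j)) atTop Θl := by
    refine tendstoInMeasure_of_tendsto_eLpNorm one_ne_zero (fun j => (hΘnm _).aestronglyMeasurable)
      hΘlm.aestronglyMeasurable ?_
    simpa only [eLpNorm_one_eq_lintegral_enorm, Pi.sub_apply] using hL1
  obtain ⟨ψ₂, hψ₂, hae₂⟩ := hTIM.exists_seq_tendsto_ae
  set φ₂ : ℕ → ℕ := (φ ∘ ψ₁) ∘ ψ₂ with hφ₂
  have hW₂ : IsDiPernaLionsWeakLimit f₀ fseq φ₂ f := hW₁.comp_strictMono hψ₂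
  have hmass₂ : ∀ᵐ p : ℝ × E ∂(baseSlabMeasure E t),
      Tendsto (fun j => ∫ ξ, fseq (φ₂ j) p.1 p.2 ξ) atTop (𝓝 (∫ ξ, f p.1 p.2 ξ)) := by
    filter_upwards [hmass₁ t] with p hp
    exact hp.comp hψ₂.tendsto_atTop
  set μZ : Measure (ℝ × E × E) := ((volume : Measure ℝ).restrict (Ioc 0 t)).prod
    ((volume : Measure E).prod (volume : Measure E)) with hμZ
  have hle : μZ ≤ (volume : Measure (ℝ × E × E)) := by
    rw [hμZ, Measure.volume_eq_prod, Measure.volume_eq_prod]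
    exact Measure.prod_mono Measure.restrict_le_self le_rfl
  have hΘae : ∀ᵐ q ∂μZ, Tendsto (fun j => Θn (φ₂ j) q) atTop (𝓝 (Θl q)) :=
    (Measure.absolutelyContinuous_of_le hle).ae_le hae₂
  -- ### step 2: the limits along `φ₂`
  have hLHS := hW₂.tendsto_setLIntegral_sharp hsol ht.le hC
  have hmain := fun N : ℕ => tendsto_lintegral_mainTerm_seq hB hf₀ hδ hanti hlim hker hdata hsol hbd hW₂ ht hmass₂
    (Φ := fun j => Θn (φ₂ j)) (fun j => hΘnm _) (fun j q => (hΘn01 _ q).1) zero_le_one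
    (fun j q => (hΘn01 _ q).2) hΘlm (fun q => (hΘl01 q).1) (fun q => (hΘl01 q).2) hΘae
    (M := (N : ℝ)) (Nat.cast_nonneg N) (R₁ := (N : ℝ)) (Nat.cast_nonneg N) (Λ := (N : ℝ)) (Nat.cast_nonneg N)
  have hsup := tendsto_lintegral_truncatedLimit hB hW.measurable hW.nonneg t hΘlm (fun q => (hΘl01 q).1)
  -- ### step 3: the lower bound for each truncation level
  set Dinf : ℝ≥0∞ := ∫⁻ z in C, ENNReal.ofReal (f 0 z.1 z.2 * exp (-(F t z.1 z.2))) ∂μ with hDinf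
  set LHS : ℝ≥0∞ := ∫⁻ z in C, ENNReal.ofReal (f t (z.1 + t • z.2) z.2) ∂μ with hLHSdef
  have hkey : ∀ N : ℕ, Dinf + (∫⁻ y in {y : (ℝ × E) × ((E × E) × sphere (0 : E) 1) |
      ‖y.2.1.1‖ ^ 2 + ‖y.2.1.2‖ ^ 2 ≤ (N : ℝ) ^ 2},
      ENNReal.ofReal (f y.1.1 y.1.2 y.2.1.1 * f y.1.1 y.1.2 y.2.1.2 *
        (softCutoff N (∫ ξ, |f y.1.1 y.1.2 ξ|) * Θl (y.1.1, y.1.2, (collide y.2.2 y.2.1).2) *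
          min (B y.2.1 y.2.2) N))
      ∂((((volume : Measure ℝ).restrict (Ioc 0 t)).prod (volume : Measure E)).prod
        (((volume : Measure E).prod volume).prod (sphereMeasure (E := E))))) ≤ LHS := by
    intro N
    refine ENNReal.le_of_forall_pos_le_add fun ε hε _ => ?_
    have hε' : (0 : ℝ) < ε := by exact_mod_cast hε
    have hdat := eventually_setLIntegral_data_ge hB hf₀ hδ hanti hlim hker hdata hsol hbd hW₂ ht.le (C := C) hCsub hε'
    have hlow := fun j => setLIntegral_data_add_mainTerm_le_sharp hδ hker hsol φ₂ ht hC N j (B := B)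
    have hev : ∀ᶠ j in atTop, Dinf + ∫⁻ y, ENNReal.ofReal ((Θn (φ₂ j)) (y.1.1, y.1.2, y.2.1.1) *
        softCutoff N (∫ ξ, clampDensity (fseq (φ₂ j)) (y.1.1, y.1.2, ξ)) *
        ((velBall (N : ℝ)).indicator (fun p => min (Bseq (φ₂ j) p y.2.2) (N : ℝ)) y.2.1 *
          (clampDensity (fseq (φ₂ j)) (y.1.1, y.1.2, (collide y.2.2 y.2.1).1) *
            clampDensity (fseq (φ₂ j)) (y.1.1, y.1.2, (collide y.2.2 y.2.1).2))))
        ∂((((volume : Measure ℝ).restrict (Ioc 0 t)).prod (volume : Measure E)).prod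
          (((volume : Measure E).prod volume).prod (sphereMeasure (E := E)))) ≤
        (∫⁻ z in C, ENNReal.ofReal (fseq (φ₂ j) t (z.1 + t • z.2) z.2) ∂μ) + ε := by
      filter_upwards [hdat] with j hj
      rw [← ENNReal.ofReal_coe_nnreal]
      calc _ ≤ ((∫⁻ z in C, ENNReal.ofReal (fseq (φ₂ j) 0 z.1 z.2 *
            exp (-(truncatedDampingExponent (δ (φ₂ j)) (Bseq (φ₂ j)) (fseq (φ₂ j)) t z.1 z.2))) ∂μ) +
            ENNReal.ofReal ε) + _ := add_le_add hj le_rfl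
        _ = _ := add_right_comm _ _ _
        _ ≤ _ := add_le_add (hlow j) le_rfl
    exact le_of_tendsto_of_tendsto (tendsto_const_nhds.add (hmain N)) (hLHS.add tendsto_const_nhds) hev
  -- ### step 4: remove the truncation and identify the limit pairing
  have hfinal : Dinf + ∫⁻ q, ENNReal.ofReal (Θl q) * eGain B f q ∂μZ ≤ LHS :=
    le_of_tendsto' (tendsto_const_nhds.add hsup) hkey
  have hm : Measurable fun z : E × E => ENNReal.ofReal (f 0 z.1 z.2 * exp (-(F t z.1 z.2))) :=
    ((hW.measurable_slice 0).mul (hFm.comp (measurable_const.prodMk measurable_id)).neg.exp).ennreal_ofReal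
  rw [lintegral_add_left hm]
  exact (add_le_add le_rfl (hW.setLIntegral_eDampedGainPrimitive_le hB hf₀ hδ hanti hlim hker hdata hsol hbd
    t hC)).trans hfinal

/-- **The DiPerna–Lions weak limit is an exponential supersolution** (CIP 1994 §5.3 Lemma 5.3.12,
proof, (3.38)–(3.40), p. 158: "`f ≥ f₀ e^{-F} + T_F⁻¹ Q₊(f,f)`"): in the setting of
`diPernaLions_extraction`, every weak limit `f` satisfies `IsExpSupersolution B f`, i.e. for every
`t ≥ 0`, a.e. in `(x, v)`, `f(0) e^{-F♯(t)} + ∫₀ᵗ Q₊(f,f)♯(s) e^{-(F♯(t)-F♯(s))} ds ≤ f♯(t)` in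
`[0, ∞]`. This is the hypothesis `hsup` of `diPernaLions_limit_expDuhamel_of`. [cite: CIPDiluteGases1994, §5.3 Lemma 5.3.12, proof (3.38)–(3.40) (p. 158)] -/
theorem IsDiPernaLionsWeakLimit.isExpSupersolution (hW : IsDiPernaLionsWeakLimit f₀ fseq φ f)
    (hB : IsDiPernaLionsKernel B) (hf₀ : HasDiPernaLionsData f₀) (hδ : ∀ n, 0 < δ n) (hanti : Antitone δ)
    (hlim : Tendsto δ atTop (𝓝 0)) (hker : IsDiPernaLionsKernelApproximation B Bseq)
    (hdata : IsDiPernaLionsDataApproximation f₀ (fun n => fseq n 0))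
    (hsol : ∀ n, IsDiPernaLionsApproximateSolution (δ n) (Bseq n) (fseq n))
    (hbd : UniformDiPernaLionsBounds δ Bseq fseq) : IsExpSupersolution B f := by
  intro t ht
  rcases ht.lt_or_eq with ht | ht
  swap
  · subst ht
    refine ae_of_all _ fun z => ?_
    rw [alongFreeFlow_zero, dampingExponent_zero, neg_zero, exp_zero, mul_one, eDampedGainPrimitive_zero, add_zero]
  set μ : Measure (E × E) := (volume : Measure E).prod volume with hμ
  set u : E × E → ℝ≥0∞ := fun z => ENNReal.ofReal (f t (z.1 + t • z.2) z.2) with hu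
  set w : E × E → ℝ≥0∞ := fun z => ENNReal.ofReal (f 0 z.1 z.2 * exp (-(dampingExponent B f t z.1 z.2))) +
    eDampedGainPrimitive B f t z.1 z.2 with hw
  have hFm : Measurable fun a : ℝ × E × E => dampingExponent B f a.1 a.2.1 a.2.2 :=
    measurable_dampingExponent hB.measurable hW.measurable
  have hDGPm : Measurable fun z : E × E => eDampedGainPrimitive B f t z.1 z.2 := by
    have hI : Measurable fun p : (E × E) × ℝ => eGain B f (p.2, p.1.1 + p.2 • p.1.2, p.1.2) *
        ENNReal.ofReal (exp (-(dampingExponent B f t p.1.1 p.1.2 - dampingExponent B f p.2 p.1.1 p.1.2))) := by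
      have hsh : Measurable fun p : (E × E) × ℝ => ((p.2, p.1.1 + p.2 • p.1.2, p.1.2) : ℝ × E × E) :=
        measurable_snd.prodMk ((measurable_fst.fst.add (measurable_snd.smul measurable_fst.snd)).prodMk measurable_fst.snd)
      refine ((measurable_eGain hB.measurable hW.measurable).comp hsh).mul ?_
      exact (((hFm.comp (measurable_const.prodMk measurable_fst)).sub
        (hFm.comp (measurable_snd.prodMk measurable_fst))).neg.exp).ennreal_ofReal
    have h := hI.lintegral_prod_right' (ν := (volume : Measure ℝ).restrict (Ioc 0 t))
    have heq : (fun z : E × E => eDampedGainPrimitive B f t z.1 z.2) = fun z => ∫⁻ s in Ioc 0 t,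
        eGain B f (s, z.1 + s • z.2, z.2) *
          ENNReal.ofReal (exp (-(dampingExponent B f t z.1 z.2 - dampingExponent B f s z.1 z.2))) :=
      funext fun z => eDampedGainPrimitive_apply B f t z.1 z.2
    rw [heq]
    exact h
  have hwm : Measurable w :=
    (((hW.measurable_slice 0).mul (hFm.comp (measurable_const.prodMk measurable_id)).neg.exp).ennreal_ofReal).add hDGPm
  suffices h : ∀ n : ℕ, ∀ᵐ z ∂(μ.restrict (univ ×ˢ closedBall (0 : E) n)), w z ≤ u z by
    have hcover : (univ : Set (E × E)) ⊆ ⋃ n : ℕ, (univ : Set E) ×ˢ closedBall (0 : E) n := by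
      intro z _
      obtain ⟨n, hn⟩ := exists_nat_ge ‖z.2‖
      exact mem_iUnion.2 ⟨n, mem_univ _, mem_closedBall_zero_iff.2 hn⟩
    have h' : ∀ᵐ z ∂(μ.restrict (⋃ n : ℕ, (univ : Set E) ×ˢ closedBall (0 : E) n)), w z ≤ u z :=
      (ae_restrict_iUnion_iff _ _).2 h
    have h'' : ∀ᵐ z ∂μ, w z ≤ u z := by
      have := ae_restrict_of_ae_restrict_of_subset hcover h'
      rwa [Measure.restrict_univ] at this
    simpa only [hu, hw, alongFreeFlow_apply] using h''
  intro n
  haveI : SigmaFinite (μ.restrict ((univ : Set E) ×ˢ closedBall (0 : E) n)) := by rw [hμ]; infer_instance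
  refine ae_le_of_forall_setLIntegral_le_of_sigmaFinite hwm fun s hs _ => ?_
  rw [Measure.restrict_restrict hs]
  have hsub : s ∩ (univ : Set E) ×ˢ closedBall (0 : E) n ⊆ (univ : Set E) ×ˢ closedBall (0 : E) (n : ℝ) :=
    inter_subset_right
  exact hW.setLIntegral_sharp_ge hB hf₀ hδ hanti hlim hker hdata hsol hbd ht (hs.inter
    (MeasurableSet.univ.prod measurableSet_closedBall)) hsub


end Supersolution

/-! ## Discharges: (L12), (S14) and the weak stability theorem -/

section Discharges

universe u

/-- **(L12) holds**: the DiPerna–Lions weak limit satisfies the exponential (Duhamel) form along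
characteristics with `f♯`, `(Q₊(f,f))♯ ∈ L¹_loc` (CIP 1994 §5.3 Lemma 5.3.12): the proved assembly
`diPernaLions_limit_expDuhamel_of` fed with the two halves
`IsDiPernaLionsWeakLimit.isExpSupersolution` ((3.38)–(3.40)) and
`IsDiPernaLionsWeakLimit.isExpSubsolution` (display before (3.44)). [cite: CIPDiluteGases1994, §5.3 Lemma 5.3.12 (pp. 157–159)] -/
theorem diPernaLions_limit_expDuhamel_holds : diPernaLions_limit_expDuhamel.{u} := by
  refine diPernaLions_limit_expDuhamel_of ?_ ?_
  · intro E _ _ _ _ _ B hB f₀ hf₀ δ Bseq fseq hδ hanti hlim hker hdata hsol hbd φ f hW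
    exact hW.isExpSupersolution hB hf₀ hδ hanti hlim hker hdata hsol hbd
  · intro E _ _ _ _ _ B hB f₀ hf₀ δ Bseq fseq hδ hanti hlim hker hdata hsol hbd φ f hW
    exact hW.isExpSubsolution hB hf₀ hδ hanti hlim hker hdata hsol hbd

/-- **(S14) holds**: the DiPerna–Lions weak limit is an a.e.-mild solution with the local
integrability of `Q±(f,f)♯` (CIP 1994 §5.3 Lemma 5.3.12 with Step 14 (3.45)–(3.49)):
`diPernaLions_limit_isAEMildSolution_of_expDuhamel` (the tree's reduction to (L12), with (E49)
`diPernaLions_limit_gain_le_loss_holds`) applied to `diPernaLions_limit_expDuhamel_holds`. [cite: CIPDiluteGases1994, §5.3 Lemma 5.3.12 and Step 14 (3.45)–(3.49) (pp. 157–160)] -/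
theorem diPernaLions_limit_isAEMildSolution_holds : diPernaLions_limit_isAEMildSolution.{u} :=
  diPernaLions_limit_isAEMildSolution_of_expDuhamel diPernaLions_limit_expDuhamel_holds

/-- **The DiPerna–Lions weak stability theorem holds** (DiPerna–Lions 1989, Theorem p. 322,
stability part; CIP 1994 §5.3 Steps 8–14): the tree's reduction
`diPernaLions_weakStability_of_expDuhamel` applied to `diPernaLions_limit_expDuhamel_holds`. [cite: DiPernaLionsAnnals1989, Theorem p. 322 (stability part)]
[cite: CIPDiluteGases1994, §5.3 Steps 8–14 (pp. 147–160)] -/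
theorem diPernaLions_weakStability_holds : diPernaLions_weakStability.{u} :=
  diPernaLions_weakStability_of_expDuhamel diPernaLions_limit_expDuhamel_holds

end Discharges

end Literature.MathematicalPhysics.KineticTheory
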